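import Literature.MathematicalPhysics.QuantumFieldTheory.Balaban1983to89.B4CubeGreenRegion
import Literature.MathematicalPhysics.QuantumFieldTheory.Balaban1983to89.B4LpNormTransfer
import Literature.MathematicalPhysics.QuantumFieldTheory.Balaban1983to89.B4Eq221PsupCubeField
import Literature.MathematicalPhysics.QuantumFieldTheory.Balaban1983to89.B4Eq221HjRegion

/-!
# `Balaban1983to89.B4Thm110RegionLp` — [Balaban1983RegularityDecay] THEOREM p. 573, INEQUALITY (1.10) (value member)
# FOR A GENERAL REGION `Ω` (a finite union of big blocks) UNDER THE PRINTED `R₀` RESTRICTION, END TO END, for a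
# (1.7)-regular vector field — the print's own route (2.2)–(2.22): interior cubes by Lemma 2.2 at `Ã_j`, boundary cubes
# `Ω ∩ □_j` by Lemma 2.1's `‖·‖_{2,2}` only, the mixed `L^p` chain (2.18)–(2.21) and the tail (2.22)

statement-level skeleton of published theorems with citation tags; proofs where landed; nothing here is a claim about the Yang–Mills mass gap

CITATION HEADER.  T. Bałaban, *Regularity and decay of lattice Green's functions*, Commun. Math. Phys. **89** (1983)
571–597, doi:10.1007/bf01214744 [Balaban1983RegularityDecay] (cell paper B4; held text
`paper:balaban1983-cmp89-regularity-decay`, journal page = PDF page + 570; pp. 573, 575–579).  Unit `lit-balaban-r01`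
gen 7 (B4 fold owner), HOME `run/shared/lean/pub/lit-balaban/`, SKELETON row **B4.Thm@573** (file 4 of the r01 g7
programme).  Imports: r01 g7 `B4CubeGreenRegion` (cut cube data, `hGj`, plateau lemmas), `B4LpNormTransfer` (norm
transfer), `B4Eq221PsupCubeField` (graded factor `‖·‖_{∞,p₁}`) → p35 g6 `B4Eq220CubeField` (Lemma 2.2 / (2.20) /
(2.21) at `Ã_j` for a (1.7)-regular `A`); p35 g5 `B4Eq221HjRegion` (Lemma 2.1's `‖·‖_{2,2}` factor on any union of
`K`-blocks); r01 g6 `B4Ineq110LpChain.ineq110_value_lp_apply` (the mixed chain (2.18)–(2.22) with `R₀` in label form).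

WHAT IS PRINTED (verbatim, p. 573). «Theorem. … there exist positive constants δ₀, c₀, R₀, where δ₀, R₀ depend on d and
M only, c₀ depends on … such that for e sufficiently small and for an arbitrary function f: Ω → R^N …
|(G_k(Ω, A)f)(x)| ≤ c₀ exp(−δ₀ dist(x, supp f)) ‖f‖_∞, (1.10) for x ∈ Ω, dist(x, Ω^c) ≥ R₀»; p. 575 «if □_j intersects
the boundary of Ω, then A_j = A; if □_j is an interior cube of Ω, then … Ã_j = A₀ + θ_jA′»; p. 579 «we do not have the
inequalities (2.16) for the norms other than L₂-norms if □_j is not a cube. … This is the reason for which we have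
introduced the restriction dist(□_{ω₀}, Ω^c) ≥ R₀».

WHAT THIS MODULE PROVES (all in full).
* §1 THE PRINT's CHOICE OF `A_j` AND `G_k(□_j, A_j)` on a general `Ω`: `atField` (interior cube: p35's `cubeField`
  `Ã_j = A₀ + θ_j(A − A₀)`, `A₀ = A` at the cube's lower corner; boundary cube: `A`), `atGreen` (interior:
  `B4CubeGreenRegion.cubeGreenB`, boundary: `cubeGreenI`); the translated field `AcS` and box field `boxFld` on the
  `2K`-box; bridging identities `subFieldB_atField`, `subFieldI_atField_bad`, `hCube_boxEmb`, `hCube_incl`,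
  `boxLetter_eq`, `subLetter_eq`; `atField_core` («Ã_j = A on the ¾-core»), `atGreen_mul` (`hGj`), `good_of_R0`
  (the printed `dist(x, Ω^c) ≥ R₀` in label form ⇒ the chain's `R₀` condition: every cube within `n₀` labels of a cube
  seeing `x` is interior).
* §2 **`thm110_value_region_of_inputs`** — (1.10) on `fineDom n Ωc` from the per-cube inputs IN P35's VOCABULARY
  (Lemma 2.2 sup member and the (2.20)/(2.21) letters on the translated `2K`-boxes at the interior cubes; the
  `‖·‖_{2,2}` letter of the sub-regions `Ω ∩ □̂_j` at all cubes) and `3^{d+1}√N c_K ≤ e^{−1}`: every structural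
  hypothesis of `ineq110_value_lp_apply` discharged.
* §3 **`thm110_value_region`** — THE THEOREM (1.10), value member, for a GENERAL `Ω` under `R₀`, HYPOTHESIS-FREE but for
  the print's own: `∃ K ≥ 8` (the cube size `M = K` unit blocks, `8 ∣ K`), `∃ c₀ > 0`, for every regularity pair
  `(c, β)`: `∃ e₁ > 0` such that for every step `k ≥ 1` (`η = L^{-k}`, `L ≥ 2`), `a ∈ [a₋, a₊]`, `0 ≤ m² ≤ m₊²`,
  every finite union `Ω` of `K`-blocks, every vector field `A` (component form) regular (1.7) on `Ω` with `0 < e ≤ e₁`,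
  every site `x` with all unit labels within `K(d+3)` of its block in `Ω` (`R₀`), every `f` supported at
  `ℓ^∞`-distance `≥ D` from `x` with `‖f‖_{2,η} ≤ V‖f‖_∞`:
  `|(G_k(Ω,A)f)(x)_i| ≤ c₀·V·e^{−D/(nK)}·‖f‖_∞` — `δ₀ = 1/K` per `η`-unit length; `lpv_two_le_unitBlock` and
  **`thm110_value_region_unitBlock`** (`f` supported in one unit block: `‖f‖_{2,η} ≤ √N‖f‖_∞`, the print's «it is
  sufficient to prove the Proposition for a function f with support in a unit cube» (pp. 574–575), so `|(G_k(Ω,A)f)(x)_i| ≤ c₀e^{−D/(nK)}‖f‖_∞`).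
HONEST SCOPE.  (i) `A` abelian one-parameter orthogonal flow `U = F.U`, component field `A_ν(x)` with [B4]'s staircase
contours (the lineage's setting); (ii) `R₀ = K(d+3)` unit lengths in the `ℓ^∞` label metric (print: «R₀ depend[s] on d
and M only»); (ii′) (v1.1, referee note F3) the print FIXES the block size `M` first, depending on `d` only (and `c₀` on `α`),
whereas here the cube size `K` (= `M` in unit blocks) is CHOSEN existentially after `d`, `N`, the flow's Lipschitz constant,
`L` and the windows `[a₋, a₊]`, `m₊²` (through the Lemma-2.2 / Lemma-2.1 constants), so `δ₀ = 1/K` and `R₀ = K(d+3)`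
inherit that dependence — a weakening of «depending on d and M only» by the choice of `M`; (iii) the value member (1.10) only — (1.9), (1.11), (1.12) for general `Ω` remain as r01 g6's chain
theorems modulo per-cube inputs; (iv) the `L²`-comparison `‖f‖_{2,η} ≤ V‖f‖_∞` is kept as the print keeps it (unit-cube
supports, `V = √N` for `N` colours).  Definitions with bodies (`atField`, `atGreen`, abbrevs `AcS`, `boxFld`) and
theorems; no `Prop` fact, no `sorry`; axioms standard.  v1.1: docstring clause (ii′) only, no declaration changed.
-/

namespace Literature.MathematicalPhysics.QuantumFieldTheory.Balaban1983to89.B4Thm110RegionLp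

open Literature.MathematicalPhysics.QuantumFieldTheory.Balaban1983to89.B4Reflection242 (boxDom mem_boxDom nbrs mem_nbrs
  blk blk_mem_boxDom)
open Literature.MathematicalPhysics.QuantumFieldTheory.Balaban1983to89.B4GaugeCovariance
open Literature.MathematicalPhysics.QuantumFieldTheory.Balaban1983to89.B4Commutators25to211 (mulH opK)
open Literature.MathematicalPhysics.QuantumFieldTheory.Balaban1983to89.B4Lower18 (fineDom mem_fineDom IsBlockUnion)
open Literature.MathematicalPhysics.QuantumFieldTheory.Balaban1983to89.B4Lower18Regular (e1 baseEmb stairContour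
  base_le_of_blk)
open Literature.MathematicalPhysics.QuantumFieldTheory.Balaban1983to89.B4Lower18RegularRegion (regWt rBlkWt rbaseEmb
  rstairContour regWt_nonneg rBlkWt_ne_zero compField)
open Literature.MathematicalPhysics.QuantumFieldTheory.Balaban1983to89.B4Lemma22ReduceZero (Box opA greenA)
open Literature.MathematicalPhysics.QuantumFieldTheory.Balaban1983to89.B4Lemma22Reduce231 (supN supN_nonneg)
open Literature.MathematicalPhysics.QuantumFieldTheory.Balaban1983to89.B4Lemma22EtaBox (vol vol_pos lpW lpW_nonneg)
open Literature.MathematicalPhysics.QuantumFieldTheory.Balaban1983to89.B4Lemma22LpStair (lpM lpM_nonneg)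
open Literature.MathematicalPhysics.QuantumFieldTheory.Balaban1983to89.B4PartitionUnity22 (hCube hCube_ne_zero_imp hprof
  D1 D2 D1_nonneg D2_nonneg contDiff_hprof hasCompactSupport_hprof)
open Literature.MathematicalPhysics.QuantumFieldTheory.Balaban1983to89.B4Eq220PartitionSizes (hZ hBox)
open Literature.MathematicalPhysics.QuantumFieldTheory.Balaban1983to89.B4Eq220CommutatorField (kOp)
open Literature.MathematicalPhysics.QuantumFieldTheory.Balaban1983to89.B4CubeFields22 (cubeField cubeField_eq_compField)
open Literature.MathematicalPhysics.QuantumFieldTheory.Balaban1983to89.B4CubeFieldHyps22 (aSeq_window cubeField_threshold)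
open Literature.MathematicalPhysics.QuantumFieldTheory.Balaban1983to89.B4Eq220CubeField (lemma22_sup_cubeField
  eq220_cubeField_std eq221_cubeField)
open Literature.MathematicalPhysics.QuantumFieldTheory.Balaban1983to89.B4Eq221PsupCubeField (eq221_psup_cubeField_std)
open Literature.MathematicalPhysics.QuantumFieldTheory.Balaban1983to89.B4Eq221L2FactorRegion (acBond kOpR)
open Literature.MathematicalPhysics.QuantumFieldTheory.Balaban1983to89.B4Eq221HjRegion (eq221_l2_region_hZ)
open Literature.MathematicalPhysics.QuantumFieldTheory.Balaban1983to89.B4Lemma21Region (regionOp)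
open Literature.MathematicalPhysics.QuantumFieldTheory.Balaban1983to89.B4CubeOpReindex
open Literature.MathematicalPhysics.QuantumFieldTheory.Balaban1983to89.B4WalkRouteRegion (rpos labels labels_complete
  regWt_local rBlkWt_local green_mul_op)
open Literature.MathematicalPhysics.QuantumFieldTheory.Balaban1983to89.B4RegionCubeCarrier
open Literature.MathematicalPhysics.QuantumFieldTheory.Balaban1983to89.B4CubeGreenRegion
open Literature.MathematicalPhysics.QuantumFieldTheory.Balaban1983to89.B4LpNormTransfer
open Literature.MathematicalPhysics.QuantumFieldTheory.Balaban1983to89.B4Ineq110LpChain (lpv lpv_nonneg lvl lvl_zero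
  lvl_succ lpv_two_le ineq110_value_lp_apply)
open scoped Matrix
open scoped Matrix.Norms.Operator

noncomputable section

variable {d : ℕ}

section Data

variable {ι : Type} [Fintype ι] [DecidableEq ι] (F : OrthFlow ι) (κ : ℝ)
variable (ℓ k : ℕ) (Ωc : Finset (Fin (d + 1) → ℤ)) (K : ℕ) (Ac : (Fin (d + 1) → ℤ) → Fin (d + 1) → ℝ)

/-- the mesh `n = L^k ≥ 1`. [folklore] -/
private theorem one_le_n : 1 ≤ (ℓ + 1) ^ k := Nat.one_le_pow _ _ (Nat.succ_pos ℓ)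

/-! ## §1. The print's `A_j` and `G_k(□_j, A_j)` on a general `Ω`; bridging identities -/

omit [Fintype ι] [DecidableEq ι] in
/-- **THE TRANSLATED FIELD** `y ↦ A(y + t_j)`, `t_j = n·K(j − 1)` the cube's lower corner in fine units: the interior
cube `□_j` read on the lineage's origin-anchored `2K`-box. [cite: Balaban1983RegularityDecay, §2 p.575 «□_j is a cube of
the size 2M and with center in Mj», dictionary] -/
abbrev AcS (j : Fin (d + 1) → ℤ) : (Fin (d + 1) → ℤ) → Fin (d + 1) → ℝ :=
  fun y => Ac (y + fun i => (((ℓ + 1) ^ k : ℕ) : ℤ) * cshift K j i)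

/-- **`Ã_j` ON THE `2K`-BOX**: p35's `cubeField` of the translated field, label at the centre (`j′ = 1`), `A₀ = A` at
the lower corner. [cite: Balaban1983RegularityDecay, §2 p.575 «Ã_j = A₀ + θ_jA′», «e.g. A₀ = A(Mj)»] -/
abbrev boxFld (j : Fin (d + 1) → ℤ) :
    ↥(Box d ℓ k fun _ : Fin (d + 1) => 2 * K) → ↥(Box d ℓ k fun _ : Fin (d + 1) => 2 * K) → ℝ :=
  cubeField (Box d ℓ k fun _ : Fin (d + 1) => 2 * K) ((ℓ + 1) ^ k) K (fun _ => 1) (AcS ℓ k K Ac j 0)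
    (AcS ℓ k K Ac j)

/-- **THE PRINT's CONFIGURATIONS `A_j` OF (2.2) ON THE REGION**: at an interior cube (`□̂_j ⊆ Ω` in unit labels)
`Ã_j = A₀ + θ_j(A − A₀)` (p35's `cubeField` on `fineDom n Ωc`, `A₀ = A` at the cube's lower corner), at a boundary cube
`A_j = A`. [cite: Balaban1983RegularityDecay, (2.2) p.575 «if □_j intersects the boundary of Ω, then A_j = A; if □_j is
an interior cube of Ω, then … Ã_j»] -/
def atField (j : Fin (d + 1) → ℤ) : ↥(fineDom ((ℓ + 1) ^ k) Ωc) → ↥(fineDom ((ℓ + 1) ^ k) Ωc) → ℝ :=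
  if cubeLabels K j ⊆ Ωc then
    cubeField (fineDom ((ℓ + 1) ^ k) Ωc) ((ℓ + 1) ^ k) K j (AcS ℓ k K Ac j 0) Ac
  else acBond Ωc Ac

/-- **THE PRINT's CUBE PROPAGATORS `G_k(□_j, A_j)` OF (2.2) ON THE REGION** (as operators of the general-`Ω` chain):
interior cube → `B4CubeGreenRegion.cubeGreenB` (the lineage's `greenA` on the translated `2K`-box, padded), boundary
cube → `cubeGreenI` (the Green's function of the sub-region `Ω ∩ □̂_j`, padded).
[cite: Balaban1983RegularityDecay, (2.2) p.575 «G₀ = Σ_j h_jG_k(□_j, A_j)h_j»] -/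
def atGreen (a m2 : ℝ) (j : Fin (d + 1) → ℤ) :
    Matrix (↥(fineDom ((ℓ + 1) ^ k) Ωc) × ι) (↥(fineDom ((ℓ + 1) ^ k) Ωc) × ι) ℝ :=
  if h : cubeLabels K j ⊆ Ωc then cubeGreenB F κ ℓ k Ωc K a m2 (atField ℓ k Ωc K Ac j) h
  else cubeGreenI F κ ℓ k Ωc K m2
    (B1.aSeq a ((ℓ : ℝ) + 1) k * (((((ℓ + 1) ^ k : ℕ)) : ℝ) ^ (d + 1))⁻¹) (atField ℓ k Ωc K Ac j) j

omit [Fintype ι] [DecidableEq ι] in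
/-- `A_j = Ã_j` at an interior cube. [cite: Balaban1983RegularityDecay, (2.2) p.575] -/
theorem atField_good {j : Fin (d + 1) → ℤ} (h : cubeLabels K j ⊆ Ωc) :
    atField ℓ k Ωc K Ac j = cubeField (fineDom ((ℓ + 1) ^ k) Ωc) ((ℓ + 1) ^ k) K j (AcS ℓ k K Ac j 0) Ac :=
  if_pos h

omit [Fintype ι] [DecidableEq ι] in
/-- `A_j = A` at a boundary cube. [cite: Balaban1983RegularityDecay, (2.2) p.575] -/
theorem atField_bad {j : Fin (d + 1) → ℤ} (h : ¬ cubeLabels K j ⊆ Ωc) : atField ℓ k Ωc K Ac j = acBond Ωc Ac :=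
  if_neg h

/-- `G_k(□_j, A_j)` at an interior cube. [cite: Balaban1983RegularityDecay, (2.2) p.575] -/
theorem atGreen_good (a m2 : ℝ) {j : Fin (d + 1) → ℤ} (h : cubeLabels K j ⊆ Ωc) :
    atGreen F κ ℓ k Ωc K Ac a m2 j = cubeGreenB F κ ℓ k Ωc K a m2 (atField ℓ k Ωc K Ac j) h :=
  dif_pos h

/-- `G_k(□_j, A_j)` at a boundary cube. [cite: Balaban1983RegularityDecay, (2.2) p.575] -/
theorem atGreen_bad (a m2 : ℝ) {j : Fin (d + 1) → ℤ} (h : ¬ cubeLabels K j ⊆ Ωc) :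
    atGreen F κ ℓ k Ωc K Ac a m2 j = cubeGreenI F κ ℓ k Ωc K m2
      (B1.aSeq a ((ℓ : ℝ) + 1) k * (((((ℓ + 1) ^ k : ℕ)) : ℝ) ^ (d + 1))⁻¹) (atField ℓ k Ωc K Ac j) j :=
  dif_neg h

omit [Fintype ι] [DecidableEq ι] in
/-- **«we take Ã_j as equal to A on the cube {x: |x − Mj| ≤ ¾M}»** — for the print's `A_j` on the region, at every
cube: on two sites of the `¾M`-core `A_j(u, v) = A(u, v)`. [cite: Balaban1983RegularityDecay, §2 p.575] -/
theorem atField_core {K : ℕ} (hK : 1 ≤ K) (j : Fin (d + 1) → ℤ) (u v : ↥(fineDom ((ℓ + 1) ^ k) Ωc))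
    (hu : ∀ μ, |rpos ((ℓ + 1) ^ k) Ωc u μ - ((((ℓ + 1) ^ k : ℕ) : ℝ) * K) * j μ|
      ≤ 3 / 4 * ((((ℓ + 1) ^ k : ℕ) : ℝ) * K))
    (hv : ∀ μ, |rpos ((ℓ + 1) ^ k) Ωc v μ - ((((ℓ + 1) ^ k : ℕ) : ℝ) * K) * j μ|
      ≤ 3 / 4 * ((((ℓ + 1) ^ k : ℕ) : ℝ) * K)) :
    atField ℓ k Ωc K Ac j u v = acBond Ωc Ac u v := by
  by_cases h : cubeLabels K j ⊆ Ωc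
  · rw [atField_good ℓ k Ωc K Ac h]
    refine cubeField_eq_compField (one_le_n ℓ k) hK j _ Ac (fun μ => ?_) (fun μ => ?_)
    · have h1 := hu μ
      simp only [rpos] at h1
      linarith
    · have h1 := hv μ
      simp only [rpos] at h1
      linarith
  · rw [atField_bad ℓ k Ωc K Ac h]

omit [Fintype ι] [DecidableEq ι] in
/-- **THE INTERIOR CUBE's `Ã_j` READ ON THE `2K`-BOX IS p35's `cubeField` OF THE TRANSLATED FIELD** (label at the
centre). [cite: Balaban1983RegularityDecay, §2 p.575 «□_j is a cube of the size 2M and with center in Mj»] -/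
theorem subFieldB_atField {K : ℕ} (hK : 1 ≤ K) {j : Fin (d + 1) → ℤ} (hgood : cubeLabels K j ⊆ Ωc) :
    subFieldB ℓ k Ωc K hgood (atField ℓ k Ωc K Ac j) = boxFld ℓ k K Ac j := by
  funext a b
  show atField ℓ k Ωc K Ac j _ _ = _
  rw [atField_good ℓ k Ωc K Ac hgood]
  exact cubeField_boxEmb ℓ k (fun _ => 2 * K) (cshift K j) (shift_mem_of_cube_subset hgood) hK
    (j' := fun _ => 1) (fun i => rfl) _ Ac a b

omit [Fintype ι] [DecidableEq ι] in
/-- at a boundary cube the configuration read on the sub-region `Ω ∩ □̂_j` is `A` itself. [cite: Balaban1983RegularityDecay, (2.2) p.575 «A_j = A»] -/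
theorem subFieldI_atField_bad {j : Fin (d + 1) → ℤ} (hbad : ¬ cubeLabels K j ⊆ Ωc) :
    subFieldI ℓ k Ωc K (atField ℓ k Ωc K Ac j) j = acBond (subLabels Ωc K j) Ac := by
  funext a b
  show atField ℓ k Ωc K Ac j _ _ = _
  rw [atField_bad ℓ k Ωc K Ac hbad]
  rfl

omit [Fintype ι] [DecidableEq ι] in
/-- the walk route's `h_j` (`M = nK`) read on the translated `2K`-box is p35's `hBox` with the label at the centre.
[cite: Balaban1983RegularityDecay, §2 p.575 «h_j(x) = h(x/M − j)», dictionary] -/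
theorem hCube_boxEmb {K : ℕ} (hK : 1 ≤ K) {j : Fin (d + 1) → ℤ} (hgood : cubeLabels K j ⊆ Ωc) :
    (fun b => hCube ((((ℓ + 1) ^ k : ℕ) : ℝ) * K) j
        (rpos ((ℓ + 1) ^ k) Ωc (boxEmb ℓ k (fun _ => 2 * K) (cshift K j) (shift_mem_of_cube_subset hgood) b)))
      = hBox ((ℓ + 1) ^ k) K (fun _ => 2 * K) (fun _ => 1) :=
  funext fun b => by
    rw [hCube_rpos_eq_hZ]
    exact hZ_boxEmb ℓ k (fun _ => 2 * K) (cshift K j) (shift_mem_of_cube_subset hgood) hK (j' := fun _ => 1)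
      (fun i => rfl) b

omit [Fintype ι] [DecidableEq ι] in
/-- the walk route's `h_j` read on the sub-region `Ω ∩ □̂_j` is `hZ` there. [cite: Balaban1983RegularityDecay, §2 p.575, dictionary] -/
theorem hCube_incl (j : Fin (d + 1) → ℤ) :
    (fun a => hCube ((((ℓ + 1) ^ k : ℕ) : ℝ) * K) j
        (rpos ((ℓ + 1) ^ k) Ωc (incl (one_le_n ℓ k) (subLabels_subset Ωc K j) a)))
      = fun a : ↥(fineDom ((ℓ + 1) ^ k) (subLabels Ωc K j)) => hZ ((ℓ + 1) ^ k) K j a.1 :=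
  funext fun a => hCube_rpos_eq_hZ _ K j (incl _ _ a)

/-- **THE INTERIOR-CUBE LETTER ON THE BOX IS p35's LETTER `K_{h_j}G_k(□,Ã_j)h_j`** (`B4Eq220CubeField`'s object, with
`kOp`, `greenA`, `hBox` at the translated field). [cite: Balaban1983RegularityDecay, (2.11) p.576, (2.20)–(2.21) p.578] -/
theorem boxLetter_eq (hn : 1 ≤ (ℓ + 1) ^ k) {K : ℕ} (hK : 1 ≤ K) (a m2 : ℝ) {j : Fin (d + 1) → ℤ}
    (hgood : cubeLabels K j ⊆ Ωc) :
    opK (boxWt ((ℓ + 1) ^ k) (fun i => (ℓ + 1) ^ k * (fun _ : Fin (d + 1) => 2 * K) i)) m2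
        (B1.aSeq a ((ℓ : ℝ) + 1) k * (((((ℓ + 1) ^ k : ℕ)) : ℝ) ^ (d + 1))⁻¹)
        (blkWt ((ℓ + 1) ^ k) (fun _ => 2 * K) (fun i => (ℓ + 1) ^ k * (fun _ : Fin (d + 1) => 2 * K) i))
        (fieldLink F κ (subFieldB ℓ k Ωc K hgood (atField ℓ k Ωc K Ac j)))
        (contourTrans (fieldLink F κ (subFieldB ℓ k Ωc K hgood (atField ℓ k Ωc K Ac j))) (baseEmb hn _)
          (stairContour hn _))
        (fun b => hCube ((((ℓ + 1) ^ k : ℕ) : ℝ) * K) j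
          (rpos ((ℓ + 1) ^ k) Ωc (boxEmb ℓ k (fun _ => 2 * K) (cshift K j) (shift_mem_of_cube_subset hgood) b)))
      * greenA d F κ ℓ k a m2 (fun _ => 2 * K) (baseEmb hn _) (stairContour hn _)
          (subFieldB ℓ k Ωc K hgood (atField ℓ k Ωc K Ac j))
      * mulH (ι := ι) (fun b => hCube ((((ℓ + 1) ^ k : ℕ) : ℝ) * K) j
          (rpos ((ℓ + 1) ^ k) Ωc (boxEmb ℓ k (fun _ => 2 * K) (cshift K j) (shift_mem_of_cube_subset hgood) b)))
    = kOp F κ ((ℓ + 1) ^ k) (B1.aSeq a ((ℓ : ℝ) + 1) k) m2 (fun _ => 2 * K) (baseEmb hn _) (stairContour hn _)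
          (boxFld ℓ k K Ac j) (hBox ((ℓ + 1) ^ k) K (fun _ => 2 * K) (fun _ => 1))
      * greenA d F κ ℓ k a m2 (fun _ => 2 * K) (baseEmb hn _) (stairContour hn _) (boxFld ℓ k K Ac j)
      * mulH (ι := ι) (hBox ((ℓ + 1) ^ k) K (fun _ => 2 * K) (fun _ => 1)) := by
  rw [subFieldB_atField ℓ k Ωc Ac hK hgood, hCube_boxEmb ℓ k Ωc hK hgood]

/-- **THE BOUNDARY-CUBE LETTER ON THE SUB-REGION IS p35's `‖·‖_{2,2}` OBJECT** `K_{h_j}G_k(Ω ∩ □̂_j, A)h_j`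
(`B4Eq221HjRegion`'s, with `hZ`). [cite: Balaban1983RegularityDecay, (2.11) p.576, (2.21) p.578] -/
theorem subLetter_eq (hn : 1 ≤ (ℓ + 1) ^ k) (m2 a' : ℝ) {j : Fin (d + 1) → ℤ} (hbad : ¬ cubeLabels K j ⊆ Ωc) :
    opK (regWt ((ℓ + 1) ^ k) (fineDom ((ℓ + 1) ^ k) (subLabels Ωc K j))) m2 a'
        (rBlkWt ((ℓ + 1) ^ k) (subLabels Ωc K j) (fineDom ((ℓ + 1) ^ k) (subLabels Ωc K j)))
        (fieldLink F κ (subFieldI ℓ k Ωc K (atField ℓ k Ωc K Ac j) j))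
        (contourTrans (fieldLink F κ (subFieldI ℓ k Ωc K (atField ℓ k Ωc K Ac j) j)) (rbaseEmb hn (subLabels Ωc K j))
          (rstairContour hn (subLabels Ωc K j)))
        (fun a => hCube ((((ℓ + 1) ^ k : ℕ) : ℝ) * K) j
          (rpos ((ℓ + 1) ^ k) Ωc (incl (one_le_n ℓ k) (subLabels_subset Ωc K j) a)))
      * (covOp (regWt ((ℓ + 1) ^ k) (fineDom ((ℓ + 1) ^ k) (subLabels Ωc K j))) m2 a'
          (rBlkWt ((ℓ + 1) ^ k) (subLabels Ωc K j) (fineDom ((ℓ + 1) ^ k) (subLabels Ωc K j)))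
          (fieldLink F κ (subFieldI ℓ k Ωc K (atField ℓ k Ωc K Ac j) j))
          (contourTrans (fieldLink F κ (subFieldI ℓ k Ωc K (atField ℓ k Ωc K Ac j) j))
            (rbaseEmb hn (subLabels Ωc K j)) (rstairContour hn (subLabels Ωc K j))))⁻¹
      * mulH (ι := ι) (fun a => hCube ((((ℓ + 1) ^ k : ℕ) : ℝ) * K) j
          (rpos ((ℓ + 1) ^ k) Ωc (incl (one_le_n ℓ k) (subLabels_subset Ωc K j) a)))
    = opK (regWt ((ℓ + 1) ^ k) (fineDom ((ℓ + 1) ^ k) (subLabels Ωc K j))) m2 a'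
        (rBlkWt ((ℓ + 1) ^ k) (subLabels Ωc K j) (fineDom ((ℓ + 1) ^ k) (subLabels Ωc K j)))
        (fieldLink F κ (acBond (subLabels Ωc K j) Ac))
        (contourTrans (fieldLink F κ (acBond (subLabels Ωc K j) Ac)) (rbaseEmb hn (subLabels Ωc K j))
          (rstairContour hn (subLabels Ωc K j)))
        (fun a : ↥(fineDom ((ℓ + 1) ^ k) (subLabels Ωc K j)) => hZ ((ℓ + 1) ^ k) K j a.1)
      * (covOp (regWt ((ℓ + 1) ^ k) (fineDom ((ℓ + 1) ^ k) (subLabels Ωc K j))) m2 a'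
          (rBlkWt ((ℓ + 1) ^ k) (subLabels Ωc K j) (fineDom ((ℓ + 1) ^ k) (subLabels Ωc K j)))
          (fieldLink F κ (acBond (subLabels Ωc K j) Ac))
          (contourTrans (fieldLink F κ (acBond (subLabels Ωc K j) Ac)) (rbaseEmb hn (subLabels Ωc K j))
            (rstairContour hn (subLabels Ωc K j))))⁻¹
      * mulH (ι := ι) (fun a : ↥(fineDom ((ℓ + 1) ^ k) (subLabels Ωc K j)) => hZ ((ℓ + 1) ^ k) K j a.1) := by
  rw [subFieldI_atField_bad ℓ k Ωc K Ac hbad, hCube_incl ℓ k Ωc K j]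

/-- **`hGj` OF THE CHAIN FOR THE PRINT's `A_j`, `G_k(□_j, A_j)`** at every cube (`a > 0`, `m² ≥ 0`, `L ≥ 2`, `k ≥ 1`).
[cite: Balaban1983RegularityDecay, (2.2) p.575, (2.6) p.576] -/
theorem atGreen_mul (hℓ : 1 ≤ ℓ) (hk : 1 ≤ k) {a m2 : ℝ} (ha : 0 < a) (hm : 0 ≤ m2) (j : Fin (d + 1) → ℤ) :
    covOp (cutWt (cubeS ℓ k Ωc K j) (regWt ((ℓ + 1) ^ k) (fineDom ((ℓ + 1) ^ k) Ωc))) m2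
        (B1.aSeq a ((ℓ : ℝ) + 1) k * (((((ℓ + 1) ^ k : ℕ)) : ℝ) ^ (d + 1))⁻¹)
        (rBlkWt ((ℓ + 1) ^ k) Ωc (fineDom ((ℓ + 1) ^ k) Ωc)) (cubeW F κ ℓ k Ωc K (atField ℓ k Ωc K Ac j) j)
        (cubeT F κ ℓ k Ωc K (atField ℓ k Ωc K Ac j) j)
      * atGreen F κ ℓ k Ωc K Ac a m2 j = 1 := by
  have hn := one_le_n ℓ k
  have hn2 : 2 ≤ (ℓ + 1) ^ k := by
    calc 2 ≤ ℓ + 1 := by omega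
      _ = (ℓ + 1) ^ 1 := (pow_one _).symm
      _ ≤ (ℓ + 1) ^ k := Nat.pow_le_pow_right (Nat.succ_pos ℓ) hk
  have hL : (1 : ℝ) < (ℓ : ℝ) + 1 := by
    have : (1 : ℝ) ≤ ℓ := by exact_mod_cast hℓ
    linarith
  have hak : 0 < B1.aSeq a ((ℓ : ℝ) + 1) k := B1.aSeq_pos ha hL hk
  have hn0 : (0 : ℝ) < ((((ℓ + 1) ^ k : ℕ)) : ℝ) := by exact_mod_cast hn
  have hak' : 0 < B1.aSeq a ((ℓ : ℝ) + 1) k * (((((ℓ + 1) ^ k : ℕ)) : ℝ) ^ (d + 1))⁻¹ := by positivity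
  by_cases h : cubeLabels K j ⊆ Ωc
  · rw [atGreen_good F κ ℓ k Ωc K Ac a m2 h]
    exact cubeOp_mul_cubeGreenB F κ ℓ k Ωc K hℓ hk ha hm _ h
  · rw [atGreen_bad F κ ℓ k Ωc K Ac a m2 h]
    exact cubeOp_mul_cubeGreenI F κ ℓ k Ωc K hak' hm hn2 _ j

omit [Fintype ι] [DecidableEq ι] in
/-- **THE PRINTED `R₀` RESTRICTION IN LABEL FORM ⇒ THE CHAIN's**: if every unit label within `K(n₀ + 2)` (sup metric)
of the block of `x` lies in `Ω`, then every cube `□_l` within `n₀` labels of a cube `□_i` seeing `x` (`h_i(x) ≠ 0`,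
`M = nK`, `K ≥ 8`) is an interior cube (`□̂_l ⊆ Ω`). [cite: Balaban1983RegularityDecay, Theorem p.573 «dist(x, Ω^c) ≥
R₀», p.579 «dist(□_{ω₀}, Ω^c) ≥ R₀»] -/
theorem good_of_R0 {K : ℕ} (hK8 : 8 ≤ K) (n₀ : ℕ) (x : ↥(fineDom ((ℓ + 1) ^ k) Ωc))
    (hx : ∀ y : Fin (d + 1) → ℤ, (∀ μ, |y μ - blk ((ℓ + 1) ^ k) x.1 μ| ≤ (K : ℤ) * (n₀ + 2)) → y ∈ Ωc)
    (i : Fin (d + 1) → ℤ) (hi : hCube ((((ℓ + 1) ^ k : ℕ) : ℝ) * K) i (rpos ((ℓ + 1) ^ k) Ωc x) ≠ 0)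
    (l : Fin (d + 1) → ℤ) (hil : ∀ μ, |i μ - l μ| ≤ (n₀ : ℤ)) : cubeLabels K l ⊆ Ωc := by
  have hn := one_le_n ℓ k
  have hK1 : 1 ≤ K := le_trans (by norm_num) hK8
  have hnr : (0 : ℝ) < ((((ℓ + 1) ^ k : ℕ)) : ℝ) := by exact_mod_cast hn
  have hKr : (8 : ℝ) ≤ K := by exact_mod_cast hK8
  have hM : (0 : ℝ) < ((((ℓ + 1) ^ k : ℕ)) : ℝ) * K := by positivity
  intro y hy
  apply hx y
  intro μ
  have hb := base_le_of_blk hn (rfl : blk ((ℓ + 1) ^ k) x.1 = blk ((ℓ + 1) ^ k) x.1)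
  have h1 : ((((ℓ + 1) ^ k : ℕ) : ℤ) : ℝ) * (blk ((ℓ + 1) ^ k) x.1 μ : ℝ) ≤ ((x.1 μ : ℤ) : ℝ) := by
    exact_mod_cast hb.1 μ
  have h2 : ((x.1 μ : ℤ) : ℝ) - ((((ℓ + 1) ^ k : ℕ) : ℤ) : ℝ) * (blk ((ℓ + 1) ^ k) x.1 μ : ℝ)
      ≤ ((((ℓ + 1) ^ k : ℕ) : ℤ) : ℝ) := by
    exact_mod_cast hb.2 μ
  have h3 := hCube_ne_zero_imp hM hi μ
  simp only [rpos] at h3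
  obtain ⟨h3a, h3b⟩ := abs_lt.1 h3
  obtain ⟨hy1, hy2⟩ := mem_cubeLabels.1 hy μ
  have hy1' : ((K : ℤ) : ℝ) * ((l μ : ℝ) - 1) ≤ (y μ : ℝ) := by exact_mod_cast hy1
  have hy2' : ((y μ : ℤ) : ℝ) < (K : ℝ) * ((l μ : ℝ) + 1) := by exact_mod_cast hy2
  have hil' : |((i μ : ℤ) : ℝ) - (l μ : ℝ)| ≤ (n₀ : ℝ) := by exact_mod_cast hil μ
  obtain ⟨hila, hilb⟩ := abs_le.1 hil'
  push_cast at h1 h2 hy1' h3a h3b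
  -- the block label `b` of `x` is within `⅝K + 1 ≤ K` of `Ki`
  set b : ℝ := (blk ((ℓ + 1) ^ k) x.1 μ : ℝ) with hb_def
  set nn : ℝ := ((((ℓ + 1) ^ k : ℕ)) : ℝ) with hnn
  have hb1 : nn * b < nn * ((K : ℝ) * i μ + 5 / 8 * K) := by nlinarith
  have hb2 : nn * ((K : ℝ) * i μ - 5 / 8 * K - 1) < nn * b := by nlinarith
  have hb1' : b < (K : ℝ) * i μ + 5 / 8 * K := lt_of_mul_lt_mul_left hb1 hnr.le
  have hb2' : (K : ℝ) * i μ - 5 / 8 * K - 1 < b := lt_of_mul_lt_mul_left hb2 hnr.le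
  have key : |((y μ : ℤ) : ℝ) - b| ≤ (K : ℝ) * (n₀ + 2) := by
    rw [abs_le]
    constructor <;> nlinarith
  have key' : |((y μ - blk ((ℓ + 1) ^ k) x.1 μ : ℤ) : ℝ)| ≤ (((K : ℤ) * (n₀ + 2) : ℤ) : ℝ) := by
    push_cast
    exact key
  exact_mod_cast key'

end Data

/-! ## §2. (1.10) on a general `Ω` from the per-cube inputs in the Lemma-2.2 / Lemma-2.1 lineages' vocabulary -/

section Inputs

variable {ι : Type} [Fintype ι] [DecidableEq ι]

/-- **THEOREM (1.10), VALUE MEMBER, ON A GENERAL REGION `Ω` UNDER `R₀`, FROM THE PER-CUBE INPUTS** (every structural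
hypothesis of r01 g6's mixed chain `B4Ineq110LpChain.ineq110_value_lp_apply` DISCHARGED on [B4]'s concrete data;
`Ω = fineDom n Ωc`, `n = L^k`, `L ≥ 2`, `k ≥ 1`, cube size `K ≥ 8` unit blocks with `4 ∣ K`, `a > 0`, `m² ≥ 0`, any
component field `A`, the print's `A_j`/`G_k(□_j,A_j)` of (2.2)).  INPUTS, in the vocabulary of p35's box theorems
(`B4Eq220CubeField`) at the INTERIOR cubes (`□̂_j ⊆ Ω`; the translated field `y ↦ A(y + nK(j−1))` on the `2K`-box):
`‖G_k(□,Ã)Φ‖_∞ ≤ c_G‖Φ‖_∞` (2.17), `‖K_hG_k(□,Ã)hΦ‖_∞ ≤ c_K‖Φ‖_∞` (2.20), `‖K_hG_k(□,Ã)hΦ‖_∞ ≤ c_K‖Φ‖_{p,η}` for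
`p ≥ 2n₀` and `‖·‖_{q,η} ≤ c_K‖·‖_{p,η}` for `1 ≤ p ≤ q`, `1/p − 1/q ≤ 1/(2n₀)` (2.21); at EVERY cube, in the vocabulary
of p35's `B4Eq221HjRegion` on the sub-region `Ω ∩ □̂_j`: `‖K_{h_j}G_k(Ω∩□̂_j,A)h_jΦ‖_{2,η} ≤ c_K‖Φ‖_{2,η}`; and
`3^{d+1}·√N c_K ≤ e^{−1}` («M sufficiently large»).  `R₀` in label form: every unit label within `K(n₀+2)` of the block
of `x` lies in `Ω`.  CONCLUSION: for `f` supported in `P × ι` at `ℓ^∞`-distance `≥ D` (fine units) from `x` with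
`‖f‖_{2,η} ≤ V‖f‖_∞`: `|(G_k(Ω,A)f)(x)_i| ≤ 2^{d+2}e^{9/4}·max(√N c_G, 2)·V·e^{−D/(nK)}·‖f‖_∞`.
[cite: Balaban1983RegularityDecay, Theorem (1.10) p.573; (2.2) p.575, (2.12)–(2.13) p.577, (2.17)–(2.22) pp.578–579] -/
theorem thm110_value_region_of_inputs (F : OrthFlow ι) (κ : ℝ) {ℓ k : ℕ} (hℓ : 1 ≤ ℓ) (hk : 1 ≤ k)
    (hn : 1 ≤ (ℓ + 1) ^ k) (Ωc : Finset (Fin (d + 1) → ℤ)) {K : ℕ} (hK8 : 8 ≤ K) (hK4 : 4 ∣ K) {a m2 : ℝ}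
    (ha : 0 < a) (hm : 0 ≤ m2) (Ac : (Fin (d + 1) → ℤ) → Fin (d + 1) → ℝ) {cG cK : ℝ} (hcG : 0 ≤ cG) (hcK : 0 ≤ cK)
    {n₀ : ℕ} (hn₀ : 0 < n₀)
    (hG : ∀ j, cubeLabels K j ⊆ Ωc → ∀ Φ : ↥(Box d ℓ k fun _ : Fin (d + 1) => 2 * K) × ι → ℝ,
      supN (greenA d F κ ℓ k a m2 (fun _ => 2 * K) (baseEmb hn _) (stairContour hn _) (boxFld ℓ k K Ac j) *ᵥ Φ)
        ≤ cG * supN Φ)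
    (h0 : ∀ j, cubeLabels K j ⊆ Ωc → ∀ Φ : ↥(Box d ℓ k fun _ : Fin (d + 1) => 2 * K) × ι → ℝ,
      supN (kOp F κ ((ℓ + 1) ^ k) (B1.aSeq a ((ℓ : ℝ) + 1) k) m2 (fun _ => 2 * K) (baseEmb hn _) (stairContour hn _)
            (boxFld ℓ k K Ac j) (hBox ((ℓ + 1) ^ k) K (fun _ => 2 * K) (fun _ => 1))
          *ᵥ (greenA d F κ ℓ k a m2 (fun _ => 2 * K) (baseEmb hn _) (stairContour hn _) (boxFld ℓ k K Ac j)
            *ᵥ (mulH (ι := ι) (hBox ((ℓ + 1) ^ k) K (fun _ => 2 * K) (fun _ => 1)) *ᵥ Φ))) ≤ cK * supN Φ)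
    (h1 : ∀ j, cubeLabels K j ⊆ Ωc → ∀ p : ℝ, 2 * (n₀ : ℝ) ≤ p →
      ∀ Φ : ↥(Box d ℓ k fun _ : Fin (d + 1) => 2 * K) × ι → ℝ,
      supN (kOp F κ ((ℓ + 1) ^ k) (B1.aSeq a ((ℓ : ℝ) + 1) k) m2 (fun _ => 2 * K) (baseEmb hn _) (stairContour hn _)
            (boxFld ℓ k K Ac j) (hBox ((ℓ + 1) ^ k) K (fun _ => 2 * K) (fun _ => 1))
          *ᵥ (greenA d F κ ℓ k a m2 (fun _ => 2 * K) (baseEmb hn _) (stairContour hn _) (boxFld ℓ k K Ac j)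
            *ᵥ (mulH (ι := ι) (hBox ((ℓ + 1) ^ k) K (fun _ => 2 * K) (fun _ => 1)) *ᵥ Φ))) ≤ cK * lpW d ℓ k p Φ)
    (hg : ∀ j, cubeLabels K j ⊆ Ωc → ∀ p q : ℝ, 1 ≤ p → p ≤ q → p⁻¹ - q⁻¹ ≤ (2 * (n₀ : ℝ))⁻¹ →
      ∀ Φ : ↥(Box d ℓ k fun _ : Fin (d + 1) => 2 * K) × ι → ℝ,
      lpW d ℓ k q (kOp F κ ((ℓ + 1) ^ k) (B1.aSeq a ((ℓ : ℝ) + 1) k) m2 (fun _ => 2 * K) (baseEmb hn _)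
            (stairContour hn _) (boxFld ℓ k K Ac j) (hBox ((ℓ + 1) ^ k) K (fun _ => 2 * K) (fun _ => 1))
          *ᵥ (greenA d F κ ℓ k a m2 (fun _ => 2 * K) (baseEmb hn _) (stairContour hn _) (boxFld ℓ k K Ac j)
            *ᵥ (mulH (ι := ι) (hBox ((ℓ + 1) ^ k) K (fun _ => 2 * K) (fun _ => 1)) *ᵥ Φ))) ≤ cK * lpW d ℓ k p Φ)
    (hb : ∀ (j : Fin (d + 1) → ℤ) (Φ : ↥(fineDom ((ℓ + 1) ^ k) (subLabels Ωc K j)) × ι → ℝ),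
      lpW d ℓ k 2 (opK (regWt ((ℓ + 1) ^ k) (fineDom ((ℓ + 1) ^ k) (subLabels Ωc K j))) m2
            (B1.aSeq a ((ℓ : ℝ) + 1) k * (((((ℓ + 1) ^ k : ℕ)) : ℝ) ^ (d + 1))⁻¹)
            (rBlkWt ((ℓ + 1) ^ k) (subLabels Ωc K j) (fineDom ((ℓ + 1) ^ k) (subLabels Ωc K j)))
            (fieldLink F κ (acBond (subLabels Ωc K j) Ac))
            (contourTrans (fieldLink F κ (acBond (subLabels Ωc K j) Ac)) (rbaseEmb hn (subLabels Ωc K j))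
              (rstairContour hn (subLabels Ωc K j)))
            (fun a : ↥(fineDom ((ℓ + 1) ^ k) (subLabels Ωc K j)) => hZ ((ℓ + 1) ^ k) K j a.1)
          *ᵥ ((covOp (regWt ((ℓ + 1) ^ k) (fineDom ((ℓ + 1) ^ k) (subLabels Ωc K j))) m2
                (B1.aSeq a ((ℓ : ℝ) + 1) k * (((((ℓ + 1) ^ k : ℕ)) : ℝ) ^ (d + 1))⁻¹)
                (rBlkWt ((ℓ + 1) ^ k) (subLabels Ωc K j) (fineDom ((ℓ + 1) ^ k) (subLabels Ωc K j)))
                (fieldLink F κ (acBond (subLabels Ωc K j) Ac))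
                (contourTrans (fieldLink F κ (acBond (subLabels Ωc K j) Ac)) (rbaseEmb hn (subLabels Ωc K j))
                  (rstairContour hn (subLabels Ωc K j))))⁻¹
            *ᵥ (mulH (ι := ι) (fun a : ↥(fineDom ((ℓ + 1) ^ k) (subLabels Ωc K j)) => hZ ((ℓ + 1) ^ k) K j a.1)
              *ᵥ Φ))) ≤ cK * lpW d ℓ k 2 Φ)
    (h3 : (3 : ℝ) ^ (d + 1) * (Real.sqrt (Fintype.card ι) * cK) ≤ Real.exp (-1))
    (x : ↥(fineDom ((ℓ + 1) ^ k) Ωc))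
    (hR₀ : ∀ y : Fin (d + 1) → ℤ, (∀ μ, |y μ - blk ((ℓ + 1) ^ k) x.1 μ| ≤ (K : ℤ) * (n₀ + 2)) → y ∈ Ωc)
    (P : ↥(fineDom ((ℓ + 1) ^ k) Ωc) → Prop) [DecidablePred P] {D : ℝ}
    (hD : ∀ x', P x' → ∃ μ, D ≤ |rpos ((ℓ + 1) ^ k) Ωc x μ - rpos ((ℓ + 1) ^ k) Ωc x' μ|)
    (f : ↥(fineDom ((ℓ + 1) ^ k) Ωc) × ι → ℝ) (hfP : ∀ p, ¬ P p.1 → f p = 0) {V : ℝ} (hV : 1 ≤ V)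
    (hfV : lpv (vol d ℓ k)⁻¹ 2 f ≤ V * ‖f‖) (i : ι) :
    |((covOp (regWt ((ℓ + 1) ^ k) (fineDom ((ℓ + 1) ^ k) Ωc)) m2
          (B1.aSeq a ((ℓ : ℝ) + 1) k * (((((ℓ + 1) ^ k : ℕ)) : ℝ) ^ (d + 1))⁻¹)
          (rBlkWt ((ℓ + 1) ^ k) Ωc (fineDom ((ℓ + 1) ^ k) Ωc)) (fieldLink F κ (acBond Ωc Ac))
          (contourTrans (fieldLink F κ (acBond Ωc Ac)) (rbaseEmb hn Ωc) (rstairContour hn Ωc)))⁻¹ *ᵥ f) (x, i)|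
      ≤ 2 ^ (d + 2) * Real.exp (9 / 4) * max (Real.sqrt (Fintype.card ι) * cG) 2 * V
        * Real.exp (-(D / ((((ℓ + 1) ^ k : ℕ) : ℝ) * K))) * ‖f‖ := by
  -- abbreviations
  have hK1 : 1 ≤ K := le_trans (by norm_num) hK8
  have hn2 : 2 ≤ (ℓ + 1) ^ k := by
    calc 2 ≤ ℓ + 1 := by omega
      _ = (ℓ + 1) ^ 1 := (pow_one _).symm
      _ ≤ (ℓ + 1) ^ k := Nat.pow_le_pow_right (Nat.succ_pos ℓ) hk
  have hnr : (1 : ℝ) ≤ ((((ℓ + 1) ^ k : ℕ)) : ℝ) := by exact_mod_cast hn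
  have hn0 : (0 : ℝ) < ((((ℓ + 1) ^ k : ℕ)) : ℝ) := by positivity
  have hKr : (1 : ℝ) ≤ K := by exact_mod_cast hK1
  have hM : (0 : ℝ) < ((((ℓ + 1) ^ k : ℕ)) : ℝ) * K := by positivity
  have hL : (1 : ℝ) < (ℓ : ℝ) + 1 := by
    have : (1 : ℝ) ≤ ℓ := by exact_mod_cast hℓ
    linarith
  have hak : 0 < B1.aSeq a ((ℓ : ℝ) + 1) k := B1.aSeq_pos ha hL hk
  have hak' : 0 < B1.aSeq a ((ℓ : ℝ) + 1) k * (((((ℓ + 1) ^ k : ℕ)) : ℝ) ^ (d + 1))⁻¹ := by positivity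
  have hw : (0 : ℝ) < (vol d ℓ k)⁻¹ := inv_pos.2 (vol_pos d ℓ k)
  have hN : (0 : ℝ) ≤ Real.sqrt (Fintype.card ι) := Real.sqrt_nonneg _
  -- the injections of the cubes
  have heB : ∀ {j : Fin (d + 1) → ℤ} (hj : cubeLabels K j ⊆ Ωc),
      Function.Injective (boxEmb ℓ k (fun _ => 2 * K) (cshift K j) (shift_mem_of_cube_subset hj)) :=
    fun hj => boxEmb_injective ℓ k _ _ _
  have heI : ∀ j : Fin (d + 1) → ℤ, Function.Injective (incl hn (subLabels_subset Ωc K j)) :=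
    fun j => incl_injective hn _
  -- the support of `h_j` lies in the cube
  have hsupp : ∀ (j : Fin (d + 1) → ℤ) (z : ↥(fineDom ((ℓ + 1) ^ k) Ωc)),
      hCube (((((ℓ + 1) ^ k : ℕ)) : ℝ) * K) j (rpos ((ℓ + 1) ^ k) Ωc z) ≠ 0 → cubeS ℓ k Ωc K j z :=
    fun j z hz => cubeS_of_hCube_ne_zero ℓ k Ωc hK1 j z hz
  -- THE INTERIOR-CUBE LETTER IS THE PADDED BOX LETTER OF P35
  have hLB : ∀ {j : Fin (d + 1) → ℤ} (hj : cubeLabels K j ⊆ Ωc),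
      opK (cutWt (cubeS ℓ k Ωc K j) (regWt ((ℓ + 1) ^ k) (fineDom ((ℓ + 1) ^ k) Ωc))) m2
          (B1.aSeq a ((ℓ : ℝ) + 1) k * ((((((ℓ + 1) ^ k : ℕ)) : ℝ)) ^ (d + 1))⁻¹) (rBlkWt ((ℓ + 1) ^ k) Ωc (fineDom ((ℓ + 1) ^ k) Ωc))
          (cubeW F κ ℓ k Ωc K (atField ℓ k Ωc K Ac j) j) (cubeT F κ ℓ k Ωc K (atField ℓ k Ωc K Ac j) j)
          (fun z => hCube (((((ℓ + 1) ^ k : ℕ)) : ℝ) * K) j (rpos ((ℓ + 1) ^ k) Ωc z))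
        * atGreen F κ ℓ k Ωc K Ac a m2 j * mulH (ι := ι) (fun z => hCube (((((ℓ + 1) ^ k : ℕ)) : ℝ) * K) j (rpos ((ℓ + 1) ^ k) Ωc z))
      = pad (boxEmb ℓ k (fun _ => 2 * K) (cshift K j) (shift_mem_of_cube_subset hj))
          (kOp F κ ((ℓ + 1) ^ k) (B1.aSeq a ((ℓ : ℝ) + 1) k) m2 (fun _ => 2 * K) (baseEmb hn _) (stairContour hn _)
              (boxFld ℓ k K Ac j) (hBox ((ℓ + 1) ^ k) K (fun _ => 2 * K) (fun _ => 1))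
            * greenA d F κ ℓ k a m2 (fun _ => 2 * K) (baseEmb hn _) (stairContour hn _) (boxFld ℓ k K Ac j)
            * mulH (ι := ι) (hBox ((ℓ + 1) ^ k) K (fun _ => 2 * K) (fun _ => 1))) := by
    intro j hj
    rw [atGreen_good F κ ℓ k Ωc K Ac a m2 hj, cube_letter_b_B F κ ℓ k Ωc K a m2 _ hj _ (hsupp j),
      boxLetter_eq F κ ℓ k Ωc Ac hn hK1 a m2 hj]
  -- THE BOUNDARY-CUBE LETTER IS THE PADDED SUB-REGION LETTER OF P35
  have hLI : ∀ {j : Fin (d + 1) → ℤ} (hj : ¬ cubeLabels K j ⊆ Ωc),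
      opK (cutWt (cubeS ℓ k Ωc K j) (regWt ((ℓ + 1) ^ k) (fineDom ((ℓ + 1) ^ k) Ωc))) m2
          (B1.aSeq a ((ℓ : ℝ) + 1) k * ((((((ℓ + 1) ^ k : ℕ)) : ℝ)) ^ (d + 1))⁻¹) (rBlkWt ((ℓ + 1) ^ k) Ωc (fineDom ((ℓ + 1) ^ k) Ωc))
          (cubeW F κ ℓ k Ωc K (atField ℓ k Ωc K Ac j) j) (cubeT F κ ℓ k Ωc K (atField ℓ k Ωc K Ac j) j)
          (fun z => hCube (((((ℓ + 1) ^ k : ℕ)) : ℝ) * K) j (rpos ((ℓ + 1) ^ k) Ωc z))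
        * atGreen F κ ℓ k Ωc K Ac a m2 j * mulH (ι := ι) (fun z => hCube (((((ℓ + 1) ^ k : ℕ)) : ℝ) * K) j (rpos ((ℓ + 1) ^ k) Ωc z))
      = pad (incl hn (subLabels_subset Ωc K j))
          (opK (regWt ((ℓ + 1) ^ k) (fineDom ((ℓ + 1) ^ k) (subLabels Ωc K j))) m2 (B1.aSeq a ((ℓ : ℝ) + 1) k * ((((((ℓ + 1) ^ k : ℕ)) : ℝ)) ^ (d + 1))⁻¹)
              (rBlkWt ((ℓ + 1) ^ k) (subLabels Ωc K j) (fineDom ((ℓ + 1) ^ k) (subLabels Ωc K j)))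
              (fieldLink F κ (acBond (subLabels Ωc K j) Ac))
              (contourTrans (fieldLink F κ (acBond (subLabels Ωc K j) Ac)) (rbaseEmb hn (subLabels Ωc K j))
                (rstairContour hn (subLabels Ωc K j)))
              (fun a : ↥(fineDom ((ℓ + 1) ^ k) (subLabels Ωc K j)) => hZ ((ℓ + 1) ^ k) K j a.1)
            * (covOp (regWt ((ℓ + 1) ^ k) (fineDom ((ℓ + 1) ^ k) (subLabels Ωc K j))) m2
                (B1.aSeq a ((ℓ : ℝ) + 1) k * ((((((ℓ + 1) ^ k : ℕ)) : ℝ)) ^ (d + 1))⁻¹)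
                (rBlkWt ((ℓ + 1) ^ k) (subLabels Ωc K j) (fineDom ((ℓ + 1) ^ k) (subLabels Ωc K j)))
                (fieldLink F κ (acBond (subLabels Ωc K j) Ac))
                (contourTrans (fieldLink F κ (acBond (subLabels Ωc K j) Ac)) (rbaseEmb hn (subLabels Ωc K j))
                  (rstairContour hn (subLabels Ωc K j))))⁻¹
            * mulH (ι := ι) (fun a : ↥(fineDom ((ℓ + 1) ^ k) (subLabels Ωc K j)) => hZ ((ℓ + 1) ^ k) K j a.1)) := by
    intro j hj
    rw [atGreen_bad F κ ℓ k Ωc K Ac a m2 hj, cube_letter_b_I F κ ℓ k Ωc K m2 _ _ j _ (hsupp j),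
      subLetter_eq F κ ℓ k Ωc K Ac hn m2 _ hj]
  -- THE MIXED CHAIN
  have main := ineq110_value_lp_apply (X := ↥(fineDom ((ℓ + 1) ^ k) Ωc)) (Y := ↥Ωc) (κ := ι) hM (rpos ((ℓ + 1) ^ k) Ωc)
    (regWt ((ℓ + 1) ^ k) (fineDom ((ℓ + 1) ^ k) Ωc)) m2 (B1.aSeq a ((ℓ : ℝ) + 1) k * ((((((ℓ + 1) ^ k : ℕ)) : ℝ)) ^ (d + 1))⁻¹)
    (rBlkWt ((ℓ + 1) ^ k) Ωc (fineDom ((ℓ + 1) ^ k) Ωc)) (fieldLink F κ (acBond Ωc Ac))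
    (contourTrans (fieldLink F κ (acBond Ωc Ac)) (rbaseEmb hn Ωc) (rstairContour hn Ωc))
    (fun x z' h μ => regWt_local hn Ωc hK8 x z' h μ)
    (fun y x z' h h' μ => rBlkWt_local hn Ωc hK8 y x z' h h' μ)
    (labels (((((ℓ + 1) ^ k : ℕ)) : ℝ) * K) ((ℓ + 1) ^ k) Ωc) (fun j z h => labels_complete Ωc _ j z h)
    (fun j => cubeS ℓ k Ωc K j) (fun j z hz => inBox_of_near hn hK1 j z hz)
    (fun j => cubeW F κ ℓ k Ωc K (atField ℓ k Ωc K Ac j) j)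
    (fun j => cubeT F κ ℓ k Ωc K (atField ℓ k Ωc K Ac j) j)
    (fun j x z' hx hz' => cubeW_window F κ ℓ k Ωc hK1 j hx hz' (atField_core ℓ k Ωc Ac hK1 j x z' hx hz'))
    (fun j y x hyx hx => cubeT_window F κ ℓ k Ωc hK1 hK4 j
      (fun u v hu hv _ => atField_core ℓ k Ωc Ac hK1 j u v hu hv) y x hyx hx)
    (atGreen F κ ℓ k Ωc K Ac a m2)
    (fun j _ => atGreen_mul F κ ℓ k Ωc K Ac hℓ hk ha hm j)
    _ (green_mul_op hn Ωc F κ hak' hm (regWt ((ℓ + 1) ^ k) (fineDom ((ℓ + 1) ^ k) Ωc)) (regWt_nonneg ((ℓ + 1) ^ k) _) (fun _ _ _ => rfl)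
      (acBond Ωc Ac))
    (fun j => cubeLabels K j ⊆ Ωc)
    (γ := max (Real.sqrt (Fintype.card ι) * cG) 2) (β := Real.sqrt (Fintype.card ι) * cK)
    (w := (vol d ℓ k)⁻¹) hn₀ hw (le_max_of_le_right zero_le_two) (by positivity)
    -- `γ`: Lemma 2.2 (2.17) sup member at the interior cubes
    (fun jj hj => by
      rw [atGreen_good F κ ℓ k Ωc K Ac a m2 hj]
      refine (norm_cubeGreenB_le F κ ℓ k Ωc K hn2 a hm _ hj).trans (max_le_max ?_ ?_)
      · rw [subFieldB_atField ℓ k Ωc Ac hK1 hj]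
        exact linfty_opNorm_le_of_supN _ hcG (hG jj.1 hj)
      · rw [div_le_iff₀ (by positivity)]
        nlinarith)
    -- `β` at level 0: (2.20) at the interior cubes
    (fun jj hj => by
      rw [hLB hj, norm_pad (heB hj)]
      refine linfty_opNorm_le_of_supN _ hcK fun Φ => ?_
      rw [← Matrix.mulVec_mulVec, ← Matrix.mulVec_mulVec]
      exact h0 jj.1 hj Φ)
    -- `β` along the graded chain: (2.21) at the interior cubes
    (fun jj hj t ht1 ht2 g => by
      obtain ⟨t', rfl⟩ : ∃ t', t = t' + 1 := ⟨t - 1, by omega⟩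
      simp only [Nat.add_sub_cancel]
      rw [hLB hj]
      rcases Nat.eq_zero_or_pos t' with ht0 | htpos
      · -- `‖·‖_{∞, p₁}`
        subst ht0
        rw [lvl_zero, lvl_succ, norm_pad_mulVec (heB hj)]
        have hp0 : (0 : ℝ) < 2 * (n₀ : ℝ) / ((0 + 1 : ℕ) : ℝ) := by positivity
        have hp : 2 * (n₀ : ℝ) ≤ 2 * (n₀ : ℝ) / ((0 + 1 : ℕ) : ℝ) := by norm_num
        have hin := h1 jj.1 hj _ hp (fun q : ↥(Box d ℓ k fun _ : Fin (d + 1) => 2 * K) × ι =>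
          g (boxEmb ℓ k (fun _ => 2 * K) (cshift K jj.1) (shift_mem_of_cube_subset hj) q.1, q.2))
        rw [Matrix.mulVec_mulVec, Matrix.mulVec_mulVec] at hin
        refine (norm_bound_of_supN_lpW_bound d ℓ k hp0 hcK hin).trans ?_
        exact mul_le_mul_of_nonneg_left (lpv_res_le (heB hj) hw.le hp0 g) (by positivity)
      · -- `‖·‖_{p₁/t′, p₁/(t′+1)}`
        rw [lvl, if_neg htpos.ne', lvl, if_neg (Nat.succ_ne_zero _), lpv_pad_mulVec (heB hj) (by positivity)]
        have ht'r : (1 : ℝ) ≤ t' := by exact_mod_cast htpos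
        have ht2r : (t' : ℝ) + 1 ≤ n₀ := by exact_mod_cast ht2
        have hp0 : (0 : ℝ) < 2 * (n₀ : ℝ) / ((t' + 1 : ℕ) : ℝ) := by positivity
        have hp1 : (1 : ℝ) ≤ 2 * (n₀ : ℝ) / ((t' + 1 : ℕ) : ℝ) := by
          rw [le_div_iff₀ (by positivity)]; push_cast; linarith
        have hpq : 2 * (n₀ : ℝ) / ((t' + 1 : ℕ) : ℝ) ≤ 2 * (n₀ : ℝ) / (t' : ℝ) := by
          apply div_le_div_of_nonneg_left (by positivity) (by positivity); push_cast; linarith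
        have hq2 : (2 : ℝ) ≤ 2 * (n₀ : ℝ) / (t' : ℝ) := by
          rw [le_div_iff₀ (by positivity)]; linarith
        have hdiff : (2 * (n₀ : ℝ) / ((t' + 1 : ℕ) : ℝ))⁻¹ - (2 * (n₀ : ℝ) / (t' : ℝ))⁻¹ ≤ (2 * (n₀ : ℝ))⁻¹ := by
          have hn₀r : (0 : ℝ) < n₀ := by exact_mod_cast hn₀
          rw [inv_div, inv_div]
          push_cast
          have : ((t' : ℝ) + 1) / (2 * n₀) - t' / (2 * n₀) = (2 * (n₀ : ℝ))⁻¹ := by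
            field_simp; ring
          rw [this]
        have hin := hg jj.1 hj _ _ hp1 hpq hdiff (fun q : ↥(Box d ℓ k fun _ : Fin (d + 1) => 2 * K) × ι =>
          g (boxEmb ℓ k (fun _ => 2 * K) (cshift K jj.1) (shift_mem_of_cube_subset hj) q.1, q.2))
        rw [Matrix.mulVec_mulVec, Matrix.mulVec_mulVec] at hin
        refine (lpv_bound_of_lpW_bound d ℓ k hp0 hq2 hcK hin).trans ?_
        exact mul_le_mul_of_nonneg_left (lpv_res_le (heB hj) hw.le hp0 g) (by positivity))
    -- `β` at the last level `‖·‖_{2,2}`: (2.21) at the interior cubes, Lemma 2.1 at the boundary cubes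
    (fun jj g => by
      by_cases hj : cubeLabels K jj.1 ⊆ Ωc
      · rw [hLB hj, lpv_pad_mulVec (heB hj) two_pos]
        have hdiff : (2 : ℝ)⁻¹ - (2 : ℝ)⁻¹ ≤ (2 * (n₀ : ℝ))⁻¹ := by
          rw [sub_self]; positivity
        have hin := hg jj.1 hj 2 2 (by norm_num) le_rfl hdiff
          (fun q : ↥(Box d ℓ k fun _ : Fin (d + 1) => 2 * K) × ι =>
            g (boxEmb ℓ k (fun _ => 2 * K) (cshift K jj.1) (shift_mem_of_cube_subset hj) q.1, q.2))
        rw [Matrix.mulVec_mulVec, Matrix.mulVec_mulVec] at hin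
        refine (lpv_bound_of_lpW_bound d ℓ k two_pos le_rfl hcK hin).trans ?_
        exact mul_le_mul_of_nonneg_left (lpv_res_le (heB hj) hw.le two_pos g) (by positivity)
      · rw [hLI hj, lpv_pad_mulVec (heI jj.1) two_pos]
        have hin := hb jj.1 (fun q : ↥(fineDom ((ℓ + 1) ^ k) (subLabels Ωc K jj.1)) × ι =>
          g (incl hn (subLabels_subset Ωc K jj.1) q.1, q.2))
        rw [Matrix.mulVec_mulVec, Matrix.mulVec_mulVec] at hin
        refine (lpv_bound_of_lpW_bound d ℓ k two_pos le_rfl hcK hin).trans ?_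
        exact mul_le_mul_of_nonneg_left (lpv_res_le (heI jj.1) hw.le two_pos g) (by positivity))
    h3 x
    (fun i _ hi j _ hij => good_of_R0 ℓ k Ωc hK8 n₀ x hR₀ i hi j hij)
    P hD f hfP hV hfV i
  refine main.trans (le_of_eq ?_)
  ring

end Inputs

/-! ## §3. THE THEOREM (1.10), value member, for a general `Ω` under `R₀` — hypothesis-free -/

section Main

variable {ι : Type} [Fintype ι] [DecidableEq ι]

/-- (1.7) for `A` on `Ω` gives (1.7) for the translated field `y ↦ A(y + nK(j−1))` on the `2K`-box of an interior cube.
[cite: Balaban1983RegularityDecay, (1.7) pp.572–573, §2 p.575] -/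
theorem regular_AcS {ℓ k : ℕ} {Ωc : Finset (Fin (d + 1) → ℤ)} {K : ℕ} {Ac : (Fin (d + 1) → ℤ) → Fin (d + 1) → ℝ}
    {δ : ℝ} (h17 : ∀ x ∈ fineDom ((ℓ + 1) ^ k) Ωc, ∀ μ ν : Fin (d + 1), |Ac (x + e1 μ) ν - Ac x ν| ≤ δ)
    {j : Fin (d + 1) → ℤ} (hj : cubeLabels K j ⊆ Ωc) :
    ∀ y ∈ Box d ℓ k (fun _ : Fin (d + 1) => 2 * K), ∀ μ ν : Fin (d + 1),
      |AcS ℓ k K Ac j (y + e1 μ) ν - AcS ℓ k K Ac j y ν| ≤ δ := by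
  intro y hy μ ν
  have hmem := shift_mem_fineDom ℓ k (fun _ => 2 * K) (cshift K j) (shift_mem_of_cube_subset hj) ⟨y, hy⟩
  have h := h17 _ hmem μ ν
  show |Ac (y + e1 μ + fun i => (((ℓ + 1) ^ k : ℕ) : ℤ) * cshift K j i) ν
      - Ac (y + fun i => (((ℓ + 1) ^ k : ℕ) : ℤ) * cshift K j i) ν| ≤ δ
  rw [add_right_comm]
  exact h

/-- the constant of Lemma 2.1's `‖·‖_{2,2}` factor is uniform on the window `a_k ≥ ¾a₋`, `m² ≥ 0`.
[cite: Balaban1983RegularityDecay, Lemma 2.1 (2.15) p.577 («Then for e sufficiently small we have … ≦ c₂‖f‖₂»; the window-uniformity of the constant is the lineage՚s reading, not printed), (2.21) p.578] -/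
theorem l2_const_le (d : ℕ) {amin aplus ak m2 : ℝ} (ha : 0 < amin) (hak1 : 3 / 4 * amin ≤ ak) (hak2 : ak ≤ aplus)
    (hm : 0 ≤ m2) {s : ℝ} (hs : 0 ≤ s) :
    (2 * ((d : ℝ) + 1) * (Real.sqrt (min 2 ak / 4 + m2))⁻¹ + (1 + ak) * (min 2 ak / 4 + m2)⁻¹) * s
      ≤ (2 * ((d : ℝ) + 1) * (Real.sqrt (min 2 (3 / 4 * amin) / 4))⁻¹
          + (1 + |aplus|) * (min 2 (3 / 4 * amin) / 4)⁻¹) * s := by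
  have hγ₀ : 0 < min 2 (3 / 4 * amin) / 4 := div_pos (lt_min two_pos (by linarith)) four_pos
  have hγ : min 2 (3 / 4 * amin) / 4 ≤ min 2 ak / 4 + m2 := by
    have : min 2 (3 / 4 * amin) ≤ min 2 ak := min_le_min_left 2 hak1
    linarith
  have hγ1 : 0 < min 2 ak / 4 + m2 := lt_of_lt_of_le hγ₀ hγ
  refine mul_le_mul_of_nonneg_right ?_ hs
  have h1 : (Real.sqrt (min 2 ak / 4 + m2))⁻¹ ≤ (Real.sqrt (min 2 (3 / 4 * amin) / 4))⁻¹ :=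
    inv_anti₀ (Real.sqrt_pos.2 hγ₀) (Real.sqrt_le_sqrt hγ)
  have h2 : (min 2 ak / 4 + m2)⁻¹ ≤ (min 2 (3 / 4 * amin) / 4)⁻¹ := inv_anti₀ hγ₀ hγ
  have h3 : 1 + ak ≤ 1 + |aplus| := by linarith [le_abs_self aplus]
  have hak0 : 0 ≤ 1 + ak := by linarith
  have hi1 : 0 ≤ (Real.sqrt (min 2 ak / 4 + m2))⁻¹ := inv_nonneg.2 (Real.sqrt_nonneg _)
  have hi2 : 0 ≤ (min 2 (3 / 4 * amin) / 4)⁻¹ := inv_nonneg.2 hγ₀.le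
  have := mul_le_mul h3 h2 (inv_nonneg.2 hγ1.le) (by positivity)
  nlinarith [mul_le_mul_of_nonneg_left h1 (by positivity : (0 : ℝ) ≤ 2 * ((d : ℝ) + 1))]

/-- **THEOREM p. 573, INEQUALITY (1.10) — value member — FOR A GENERAL REGION `Ω` UNDER THE `R₀` RESTRICTION, for a
(1.7)-regular vector field, with only «e sufficiently small»** (the print's own route: (2.2) with `A_j = A` at the
boundary cubes and `Ã_j` at the interior cubes, `H·G₀ = 1 − R` (2.6)–(2.12), the walk expansion (2.13), Lemma 2.2 at
the interior cubes and Lemma 2.1's `‖·‖_{2,2}` at the boundary cubes through the mixed chain (2.18)–(2.21), the tail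
(2.22)).  There are a cube size `K ≥ 8` (`8 ∣ K`; in unit blocks, the print's `M`) and `c₀ > 0` (depending on `d`, the
colour number `N`, the flow, `L` and the windows only) such that for every regularity pair `(c, β)`, `β > 0`, there is
`e₁ > 0` with: for every step `k ≥ 1` (`η = L^{-k}`, `L = ℓ + 1 ≥ 2`), every `a ∈ [a₋, a₊]`, `0 ≤ m² ≤ m₊²`, every
finite union `Ω` of `K`-blocks of unit labels, every vector field `A` (component form) regular (1.7) on `Ω`,
`|A_ν(x + e_μ) − A_ν(x)| ≤ c·e^{β−1}·η`, with `0 < e ≤ e₁`, every site `x ∈ Ω` with `dist_∞(B(x), Ω^c) > K(d+3)` unit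
lengths (the `R₀` restriction, label form), every `f : Ω → ℝ^N` supported at `ℓ^∞`-distance `≥ D` (fine units) from `x`
with `‖f‖_{2,η} ≤ V‖f‖_∞` (`V ≥ 1`), and every colour `i`:
`|(G_k(Ω, A)f)(x)_i| ≤ c₀·V·exp(−D/(nK))·‖f‖_∞` — i.e. «|(G_k(Ω,A)f)(x)| ≤ c₀exp(−δ₀dist(x, supp f))‖f‖_∞» with
`δ₀ = 1/K` per `η`-unit of length, `G_k(Ω,A) = (−Δ^{η,N}_{A,Ω} + m² + a_kP_k(A))^{-1}` at the running coefficient `a_k`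
(`B4Lemma21Region.regionOp`). [cite: Balaban1983RegularityDecay, Theorem p.573 (1.10); §2 pp.575–579 (2.2)–(2.22);
Lemma 2.1 p.577; Lemma 2.2 pp.577–578] -/
theorem thm110_value_region (F : OrthFlow ι) {ℓ₁ : ℝ} (hℓ₁ : 0 ≤ ℓ₁)
    (hLip : ∀ t (v : ι → ℝ), ((F.U t - 1) *ᵥ v) ⬝ᵥ ((F.U t - 1) *ᵥ v) ≤ (ℓ₁ * t) ^ 2 * (v ⬝ᵥ v))
    (d ℓ : ℕ) (hℓ : 1 ≤ ℓ) (amin aplus m2plus : ℝ) (ha : 0 < amin) :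
    ∃ K : ℕ, 8 ≤ K ∧ 8 ∣ K ∧ ∃ c₀ : ℝ, 0 < c₀ ∧ ∀ (creg β : ℝ), 0 ≤ creg → 0 < β →
      ∃ e₁ : ℝ, 0 < e₁ ∧ ∀ (k : ℕ), 1 ≤ k → ∀ (hn : 1 ≤ (ℓ + 1) ^ k) (a m2 : ℝ),
      amin ≤ a → a ≤ aplus → 0 ≤ m2 → m2 ≤ m2plus →
      ∀ (Ωc : Finset (Fin (d + 1) → ℤ)), IsBlockUnion K Ωc →
      ∀ (Ac : (Fin (d + 1) → ℤ) → Fin (d + 1) → ℝ) (e : ℝ), 0 < e → e ≤ e₁ →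
        (∀ x ∈ fineDom ((ℓ + 1) ^ k) Ωc, ∀ μ ν : Fin (d + 1),
          |Ac (x + e1 μ) ν - Ac x ν| ≤ creg * e ^ (β - 1) / ((ℓ + 1) ^ k : ℕ)) →
      ∀ (x : ↥(fineDom ((ℓ + 1) ^ k) Ωc)),
        (∀ y : Fin (d + 1) → ℤ, (∀ μ, |y μ - blk ((ℓ + 1) ^ k) x.1 μ| ≤ (K : ℤ) * (d + 3)) → y ∈ Ωc) →
      ∀ (P : ↥(fineDom ((ℓ + 1) ^ k) Ωc) → Prop) [DecidablePred P] (D : ℝ),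
        (∀ x', P x' → ∃ μ, D ≤ |rpos ((ℓ + 1) ^ k) Ωc x μ - rpos ((ℓ + 1) ^ k) Ωc x' μ|) →
      ∀ (f : ↥(fineDom ((ℓ + 1) ^ k) Ωc) × ι → ℝ), (∀ p, ¬ P p.1 → f p = 0) →
      ∀ (V : ℝ), 1 ≤ V → lpv (vol d ℓ k)⁻¹ 2 f ≤ V * ‖f‖ →
      ∀ i : ι,
        |((regionOp F e hn (B1.aSeq a ((ℓ : ℝ) + 1) k) m2 Ωc Ac)⁻¹ *ᵥ f) (x, i)|
          ≤ c₀ * V * Real.exp (-(D / ((((ℓ + 1) ^ k : ℕ) : ℝ) * K))) * ‖f‖ := by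
  -- the constants of the per-cube inputs (Lemma 2.2 at `Ã_j`, (2.20), (2.21), the graded factor; Lemma 2.1)
  obtain ⟨C₁, hC₁, h₁⟩ := lemma22_sup_cubeField F hℓ₁ hLip d ℓ hℓ amin aplus m2plus ha
  obtain ⟨C₂, hC₂, h₂⟩ := eq220_cubeField_std F hℓ₁ hLip d ℓ hℓ amin aplus m2plus ha
  have hp₁ : (d : ℝ) + 1 < 2 * ((d : ℝ) + 1) := by
    have : (0 : ℝ) ≤ d := Nat.cast_nonneg d
    linarith
  obtain ⟨C₃, hC₃, h₃⟩ := eq221_cubeField F hℓ₁ hLip d ℓ hℓ amin aplus m2plus ha hp₁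
  obtain ⟨C₄, hC₄, h₄⟩ := eq221_psup_cubeField_std F hℓ₁ hLip d ℓ hℓ amin aplus m2plus ha hp₁
  have hs : 0 ≤ ((d : ℝ) + 1) * (D1 hprof + D2 hprof) := by
    have := D1_nonneg contDiff_hprof hasCompactSupport_hprof
    have := D2_nonneg contDiff_hprof hasCompactSupport_hprof
    positivity
  have hγ₀ : 0 < min 2 (3 / 4 * amin) / 4 := div_pos (lt_min two_pos (by linarith)) four_pos
  set C₅ : ℝ := (2 * ((d : ℝ) + 1) * (Real.sqrt (min 2 (3 / 4 * amin) / 4))⁻¹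
      + (1 + |aplus|) * (min 2 (3 / 4 * amin) / 4)⁻¹) * (((d : ℝ) + 1) * (D1 hprof + D2 hprof)) with hC₅
  have hC₅0 : 0 ≤ C₅ := by
    have : 0 ≤ (Real.sqrt (min 2 (3 / 4 * amin) / 4))⁻¹ := inv_nonneg.2 (Real.sqrt_nonneg _)
    have : 0 ≤ (min 2 (3 / 4 * amin) / 4)⁻¹ := inv_nonneg.2 hγ₀.le
    positivity
  set Cm : ℝ := C₂ + C₃ + C₄ + C₅ with hCm
  have hCm0 : 0 ≤ Cm := by positivity
  -- the cube size: `3^{d+1}·√N·C_max/K ≤ e^{−1}`, `8 ∣ K`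
  set X : ℝ := (3 : ℝ) ^ (d + 1) * Real.sqrt (Fintype.card ι) * Cm * Real.exp 1 with hX
  have hX0 : 0 ≤ X := by positivity
  set K : ℕ := 8 * (⌈X⌉₊ + 1) with hK
  have hK8 : 8 ≤ K := by omega
  have h8 : 8 ∣ K := ⟨⌈X⌉₊ + 1, rfl⟩
  have hK4 : 4 ∣ K := ⟨2 * (⌈X⌉₊ + 1), by omega⟩
  have hK2 : 2 ≤ K := by omega
  have hK1 : 1 ≤ K := by omega
  have hKr : (0 : ℝ) < K := by exact_mod_cast hK1
  have hKX : X ≤ K := by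
    refine (Nat.le_ceil X).trans ?_
    rw [hK]
    push_cast
    linarith [(Nat.cast_nonneg ⌈X⌉₊ : (0 : ℝ) ≤ ⌈X⌉₊)]
  set cK : ℝ := Cm / K with hcK_def
  have hcK : 0 ≤ cK := div_nonneg hCm0 hKr.le
  have h3 : (3 : ℝ) ^ (d + 1) * (Real.sqrt (Fintype.card ι) * cK) ≤ Real.exp (-1) := by
    have hexp : Real.exp 1 * Real.exp (-1) = 1 := by rw [← Real.exp_add]; norm_num
    have e : (3 : ℝ) ^ (d + 1) * (Real.sqrt (Fintype.card ι) * cK) = X / K * Real.exp (-1) := by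
      rw [hcK_def, hX]
      calc (3 : ℝ) ^ (d + 1) * (Real.sqrt (Fintype.card ι) * (Cm / K))
          = (3 : ℝ) ^ (d + 1) * Real.sqrt (Fintype.card ι) * Cm / K * (Real.exp 1 * Real.exp (-1)) := by
            rw [hexp]; ring
        _ = (3 : ℝ) ^ (d + 1) * Real.sqrt (Fintype.card ι) * Cm * Real.exp 1 / K * Real.exp (-1) := by ring
    rw [e]
    have : X / K ≤ 1 := div_le_one_of_le₀ hKX (Nat.cast_nonneg K)
    calc X / K * Real.exp (-1) ≤ 1 * Real.exp (-1) := mul_le_mul_of_nonneg_right this (Real.exp_pos _).le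
      _ = Real.exp (-1) := one_mul _
  have hCle : ∀ {C : ℝ}, C ≤ Cm → C / K ≤ cK := fun h => div_le_div_of_nonneg_right h hKr.le
  have hC₂le : C₂ / K ≤ cK := hCle (by rw [hCm]; linarith)
  have hC₃le : C₃ / K ≤ cK := hCle (by rw [hCm]; linarith)
  have hC₄le : C₄ / K ≤ cK := hCle (by rw [hCm]; linarith)
  have hC₅le : C₅ / K ≤ cK := hCle (by rw [hCm]; linarith)
  -- the constant `c₀`
  set c₀ : ℝ := 2 ^ (d + 2) * Real.exp (9 / 4) * max (Real.sqrt (Fintype.card ι) * C₁) 2 with hc₀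
  have hc₀0 : 0 < c₀ := by
    have : (0 : ℝ) < max (Real.sqrt (Fintype.card ι) * C₁) 2 := lt_max_of_lt_right two_pos
    positivity
  refine ⟨K, hK8, h8, c₀, hc₀0, fun creg β hcreg hβ => ?_⟩
  -- «for e sufficiently small»
  obtain ⟨e₁, he₁, h₁'⟩ := h₁ creg β hcreg hβ (2 * K) K hK1
  obtain ⟨e₂, he₂, h₂'⟩ := h₂ creg β hcreg hβ K hK2
  obtain ⟨e₃, he₃, h₃'⟩ := h₃ creg β hcreg hβ (2 * K) K hK2
  obtain ⟨e₄, he₄, h₄'⟩ := h₄ creg β hcreg hβ K hK2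
  obtain ⟨e₅, he₅, h₅'⟩ := cubeField_threshold d (c := 0) (aplus := aplus) hℓ₁ le_rfl ha hcreg hβ 1 K
  refine ⟨min (min (min e₁ e₂) (min e₃ e₄)) e₅, lt_min (lt_min (lt_min he₁ he₂) (lt_min he₃ he₄)) he₅, ?_⟩
  intro k hk hn a m2 ea1 ea2 em1 em2 Ωc hΩ Ac e he hle h17 x hxR P _ D hD f hfP V hV hfV i
  have hle₁ : e ≤ e₁ := hle.trans ((min_le_left _ _).trans ((min_le_left _ _).trans (min_le_left _ _)))
  have hle₂ : e ≤ e₂ := hle.trans ((min_le_left _ _).trans ((min_le_left _ _).trans (min_le_right _ _)))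
  have hle₃ : e ≤ e₃ := hle.trans ((min_le_left _ _).trans ((min_le_right _ _).trans (min_le_left _ _)))
  have hle₄ : e ≤ e₄ := hle.trans ((min_le_left _ _).trans ((min_le_right _ _).trans (min_le_right _ _)))
  have hle₅ : e ≤ e₅ := hle.trans (min_le_right _ _)
  have hn2 : 2 ≤ (ℓ + 1) ^ k := by
    calc 2 ≤ ℓ + 1 := by omega
      _ = (ℓ + 1) ^ 1 := (pow_one _).symm
      _ ≤ (ℓ + 1) ^ k := Nat.pow_le_pow_right (Nat.succ_pos ℓ) hk
  have hnK : 16 ≤ (ℓ + 1) ^ k * K := le_trans (by norm_num) (Nat.mul_le_mul hn2 hK8)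
  have hnK3 : 3 ≤ (ℓ + 1) ^ k * K := le_trans (by norm_num) hnK
  have ha' : 0 < a := lt_of_lt_of_le ha ea1
  have hL : (1 : ℝ) < (ℓ : ℝ) + 1 := by
    have : (1 : ℝ) ≤ ℓ := by exact_mod_cast hℓ
    linarith
  have hak : 0 < B1.aSeq a ((ℓ : ℝ) + 1) k := B1.aSeq_pos ha' hL hk
  obtain ⟨hak1, hak2⟩ := aSeq_window hℓ hk ha ea1 ea2
  have hvol : 0 ≤ (vol d ℓ k)⁻¹ ^ (2 : ℝ)⁻¹ := Real.rpow_nonneg (inv_nonneg.2 (vol_pos d ℓ k).le) _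
  -- the standard box data
  have hM1 : ∀ _i : Fin (d + 1), 1 ≤ 2 * K := fun _ => by omega
  have hMS : ∀ _i : Fin (d + 1), 2 * K ≤ 2 * K := fun _ => le_rfl
  have hKM : ∀ _i : Fin (d + 1), K ∣ 2 * K := fun _ => Dvd.intro_left 2 rfl
  have hj1 : ∀ _i : Fin (d + 1), (1 : ℤ) ≤ 1 := fun _ => le_rfl
  have hj2 : ∀ _i : Fin (d + 1), (K : ℤ) * (1 + 1) ≤ ((2 * K : ℕ) : ℤ) := fun _ => by push_cast; omega
  -- the main chain with the inputs discharged
  have main := thm110_value_region_of_inputs F (e / ((ℓ + 1) ^ k : ℕ)) hℓ hk hn Ωc hK8 hK4 ha' em1 Ac hC₁.le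
    hcK (n₀ := d + 1) (Nat.succ_pos d)
    -- Lemma 2.2 (2.17), sup member, at `Ã_j`
    (fun j hj Φ => (h₁' k hk hn hnK a m2 ea1 ea2 em1 em2 (fun _ => 2 * K) hM1 hMS (fun _ => 1) hj1 hj2
      (AcS ℓ k K Ac j) e he hle₁ (regular_AcS h17 hj) Φ).1)
    -- (2.20)
    (fun j hj Φ => (h₂' k hk hn hnK a m2 ea1 ea2 em1 em2 (AcS ℓ k K Ac j) e he hle₂ (regular_AcS h17 hj) Φ).trans
      (mul_le_mul_of_nonneg_right hC₂le (supN_nonneg Φ)))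
    -- the graded factor `‖·‖_{∞,p₁}` of (2.21)
    (fun j hj p hp Φ => by
      have hp' : 2 * ((d : ℝ) + 1) ≤ p := by push_cast at hp; linarith
      exact (h₄' k hk hn hnK a m2 ea1 ea2 em1 em2 (AcS ℓ k K Ac j) e he hle₄ (regular_AcS h17 hj) p hp' Φ).trans
        (mul_le_mul_of_nonneg_right hC₄le (lpW_nonneg d ℓ k p Φ)))
    -- (2.21)
    (fun j hj p q hp hpq hdiff Φ => by
      have hdiff' : p⁻¹ - q⁻¹ ≤ (2 * ((d : ℝ) + 1))⁻¹ := by push_cast at hdiff; exact hdiff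
      exact (h₃' k hk hn hnK a m2 ea1 ea2 em1 em2 (fun _ => 2 * K) hM1 hMS hKM (fun _ => 1) hj1 hj2
        (AcS ℓ k K Ac j) e he hle₃ (regular_AcS h17 hj) p q hp hpq hdiff' Φ).trans
        (mul_le_mul_of_nonneg_right hC₃le (lpW_nonneg d ℓ k p Φ)))
    -- Lemma 2.1's `‖·‖_{2,2}` at every cube, on the sub-region `Ω ∩ □̂_j`
    (fun j Φ => by
      obtain ⟨_, hsm, _⟩ := h₅' e he hle₅ _ hak1 hak2
      have hsmall : ℓ₁ ^ 2 * (((d : ℝ) + 1) * creg * e ^ β) ^ 2 * ((d : ℝ) + 1)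
          * (1 + B1.aSeq a ((ℓ : ℝ) + 1) k * ((d : ℝ) + 1)) ≤ min 2 (B1.aSeq a ((ℓ : ℝ) + 1) k) / 4 := by
        simpa only [Nat.cast_one, mul_one] using hsm
      have hL := eq221_l2_region_hZ F hℓ₁ hLip he hn hak em1 (subLabels Ωc K j) hcreg
        (fun y hy => h17 y (fineDom_mono hn (subLabels_subset Ωc K j) hy)) hsmall hnK3
        (isBlockUnion_subLabels Ωc hK1 hΩ j) j Φ
      have step : lpM 2 (kOpR F e hn (B1.aSeq a ((ℓ : ℝ) + 1) k) m2 (subLabels Ωc K j) Ac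
            (fun x => hZ ((ℓ + 1) ^ k) K j x.1)
          *ᵥ ((regionOp F e hn (B1.aSeq a ((ℓ : ℝ) + 1) k) m2 (subLabels Ωc K j) Ac)⁻¹
            *ᵥ (mulH (ι := ι) (fun x : ↥(fineDom ((ℓ + 1) ^ k) (subLabels Ωc K j)) => hZ ((ℓ + 1) ^ k) K j x.1)
              *ᵥ Φ))) ≤ cK * lpM 2 Φ := by
        refine hL.trans (mul_le_mul_of_nonneg_right ?_ (lpM_nonneg 2 Φ))
        refine le_trans ?_ hC₅le
        rw [hC₅]
        calc (2 * ((d : ℝ) + 1) * (Real.sqrt (min 2 (B1.aSeq a ((ℓ : ℝ) + 1) k) / 4 + m2))⁻¹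
              + (1 + B1.aSeq a ((ℓ : ℝ) + 1) k) * (min 2 (B1.aSeq a ((ℓ : ℝ) + 1) k) / 4 + m2)⁻¹)
              * (((d : ℝ) + 1) * (D1 hprof + D2 hprof)) / K
            = (2 * ((d : ℝ) + 1) * (Real.sqrt (min 2 (B1.aSeq a ((ℓ : ℝ) + 1) k) / 4 + m2))⁻¹
              + (1 + B1.aSeq a ((ℓ : ℝ) + 1) k) * (min 2 (B1.aSeq a ((ℓ : ℝ) + 1) k) / 4 + m2)⁻¹)
              * (((d : ℝ) + 1) * (D1 hprof + D2 hprof)) * (K : ℝ)⁻¹ := div_eq_mul_inv _ _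
          _ ≤ (2 * ((d : ℝ) + 1) * (Real.sqrt (min 2 (3 / 4 * amin) / 4))⁻¹
              + (1 + |aplus|) * (min 2 (3 / 4 * amin) / 4)⁻¹) * (((d : ℝ) + 1) * (D1 hprof + D2 hprof))
              * (K : ℝ)⁻¹ := mul_le_mul_of_nonneg_right (l2_const_le d ha hak1 hak2 em1 hs) (inv_nonneg.2 hKr.le)
          _ = _ := (div_eq_mul_inv _ _).symm
      show (vol d ℓ k)⁻¹ ^ (2 : ℝ)⁻¹ * lpM 2 _ ≤ cK * ((vol d ℓ k)⁻¹ ^ (2 : ℝ)⁻¹ * lpM 2 Φ)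
      calc (vol d ℓ k)⁻¹ ^ (2 : ℝ)⁻¹ * lpM 2 _ ≤ (vol d ℓ k)⁻¹ ^ (2 : ℝ)⁻¹ * (cK * lpM 2 Φ) :=
            mul_le_mul_of_nonneg_left step hvol
        _ = cK * ((vol d ℓ k)⁻¹ ^ (2 : ℝ)⁻¹ * lpM 2 Φ) := by ring)
    h3 x
    (fun y hy => hxR y fun μ => by have h := hy μ; push_cast at h ⊢; linarith)
    P hD f hfP hV hfV i
  have hreg : regionOp F e hn (B1.aSeq a ((ℓ : ℝ) + 1) k) m2 Ωc Ac
      = covOp (regWt ((ℓ + 1) ^ k) (fineDom ((ℓ + 1) ^ k) Ωc)) m2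
          (B1.aSeq a ((ℓ : ℝ) + 1) k * (((((ℓ + 1) ^ k : ℕ)) : ℝ) ^ (d + 1))⁻¹)
          (rBlkWt ((ℓ + 1) ^ k) Ωc (fineDom ((ℓ + 1) ^ k) Ωc)) (fieldLink F (e / ((ℓ + 1) ^ k : ℕ)) (acBond Ωc Ac))
          (contourTrans (fieldLink F (e / ((ℓ + 1) ^ k : ℕ)) (acBond Ωc Ac)) (rbaseEmb hn Ωc)
            (rstairContour hn Ωc)) := rfl
  rw [hreg]
  refine main.trans (le_of_eq ?_)
  rw [hc₀]

omit [DecidableEq ι] in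
/-- **«it is sufficient to prove the Proposition for a function f with support in a unit cube»** (pp. 574–575): for `f` supported
in one unit block `B(y₀) × colours`, `‖f‖_{2,η} ≤ √N‖f‖_∞` (a unit block has `η^{-(d+1)}` sites of weight `η^{d+1}`).
[cite: Balaban1983RegularityDecay, §2 ¶1 p.575, (2.21) p.578] -/
theorem lpv_two_le_unitBlock {ℓ k : ℕ} (hn : 1 ≤ (ℓ + 1) ^ k) {Ωc : Finset (Fin (d + 1) → ℤ)} (y₀ : Fin (d + 1) → ℤ)
    (f : ↥(fineDom ((ℓ + 1) ^ k) Ωc) × ι → ℝ) (hf : ∀ p, blk ((ℓ + 1) ^ k) p.1.1 ≠ y₀ → f p = 0) :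
    lpv (vol d ℓ k)⁻¹ 2 f ≤ Real.sqrt (Fintype.card ι) * ‖f‖ := by
  classical
  have hw : 0 ≤ (vol d ℓ k)⁻¹ := inv_nonneg.2 (vol_pos d ℓ k).le
  set S : Finset (↥(fineDom ((ℓ + 1) ^ k) Ωc) × ι) :=
    Finset.univ.filter fun p => blk ((ℓ + 1) ^ k) p.1.1 = y₀ with hS
  have h1 := lpv_two_le hw S f (fun z hz => hf z (by simpa [hS] using hz))
  refine h1.trans (mul_le_mul_of_nonneg_right ?_ (norm_nonneg f))
  -- `w·#S ≤ N`: at most `n^{d+1}` sites in a unit block, `N` colours each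
  have hcard : (S.card : ℝ) ≤ vol d ℓ k * Fintype.card ι := by
    -- `S ⊆ (sites of the block) × ι`, and the sites of a block inject into `[0,n)^{d+1}`
    have hsub : S ⊆ (Finset.univ.filter fun z : ↥(fineDom ((ℓ + 1) ^ k) Ωc) => blk ((ℓ + 1) ^ k) z.1 = y₀) ×ˢ
        (Finset.univ : Finset ι) := by
      intro p hp
      rw [hS, Finset.mem_filter] at hp
      exact Finset.mem_product.2 ⟨Finset.mem_filter.2 ⟨Finset.mem_univ _, hp.2⟩, Finset.mem_univ _⟩
    have hblock : ((Finset.univ.filter fun z : ↥(fineDom ((ℓ + 1) ^ k) Ωc) => blk ((ℓ + 1) ^ k) z.1 = y₀).card : ℝ)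
        ≤ vol d ℓ k := by
      have hn0 : (0 : ℤ) < (((ℓ + 1) ^ k : ℕ) : ℤ) := by exact_mod_cast hn
      -- inject into the box `[0, n)^{d+1}` by `z ↦ z − n·y₀`
      let g : ↥(fineDom ((ℓ + 1) ^ k) Ωc) → (Fin (d + 1) → ℤ) := fun z i => z.1 i - (((ℓ + 1) ^ k : ℕ) : ℤ) * y₀ i
      have hinj : Set.InjOn g ↑(Finset.univ.filter fun z : ↥(fineDom ((ℓ + 1) ^ k) Ωc) =>
          blk ((ℓ + 1) ^ k) z.1 = y₀) := by
        intro z _ z' _ h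
        apply Subtype.ext
        funext i
        have := congr_fun h i
        simp only [g] at this
        linarith
      have himg : ∀ z ∈ (Finset.univ.filter fun z : ↥(fineDom ((ℓ + 1) ^ k) Ωc) => blk ((ℓ + 1) ^ k) z.1 = y₀),
          g z ∈ boxDom (fun _ : Fin (d + 1) => (ℓ + 1) ^ k) := by
        intro z hz
        rw [Finset.mem_filter] at hz
        have hb := base_le_of_blk hn hz.2
        rw [mem_boxDom]
        intro i
        have h1 := hb.1 i
        have h2 := hb.2 i
        simp only [g]
        constructor
        · simp only at h1; linarith
        · have : z.1 i - (((ℓ + 1) ^ k : ℕ) : ℤ) * y₀ i < (((ℓ + 1) ^ k : ℕ) : ℤ) := by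
            have hz2 := (mem_fineDom hn).1 z.2
            have hlt : z.1 i < (((ℓ + 1) ^ k : ℕ) : ℤ) * y₀ i + (((ℓ + 1) ^ k : ℕ) : ℤ) := by
              have hyi : y₀ i = z.1 i / ((((ℓ + 1) ^ k : ℕ) : ℤ)) := by rw [← hz.2]; rfl
              rw [hyi]
              have h1 := Int.mul_ediv_add_emod (z.1 i) ((((ℓ + 1) ^ k : ℕ) : ℤ))
              have h2 := Int.emod_lt_of_pos (z.1 i) hn0
              linarith
            linarith
          exact_mod_cast this
      have hle := Finset.card_le_card_of_injOn g himg hinj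
      have hbox : (boxDom (fun _ : Fin (d + 1) => (ℓ + 1) ^ k)).card = ((ℓ + 1) ^ k) ^ (d + 1) := by
        rw [boxDom, Fintype.card_piFinset]
        simp only [Int.card_Ico, sub_zero, Int.toNat_natCast, Finset.prod_const, Finset.card_univ,
          Fintype.card_fin]
      rw [hbox] at hle
      have : ((Finset.univ.filter fun z : ↥(fineDom ((ℓ + 1) ^ k) Ωc) => blk ((ℓ + 1) ^ k) z.1 = y₀).card : ℝ)
          ≤ ((((ℓ + 1) ^ k) ^ (d + 1) : ℕ) : ℝ) := by exact_mod_cast hle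
      refine this.trans (le_of_eq ?_)
      rw [vol]
      push_cast
      ring
    calc (S.card : ℝ) ≤ (((Finset.univ.filter fun z : ↥(fineDom ((ℓ + 1) ^ k) Ωc) =>
          blk ((ℓ + 1) ^ k) z.1 = y₀) ×ˢ (Finset.univ : Finset ι)).card : ℝ) := by
          exact_mod_cast Finset.card_le_card hsub
      _ = ((Finset.univ.filter fun z : ↥(fineDom ((ℓ + 1) ^ k) Ωc) => blk ((ℓ + 1) ^ k) z.1 = y₀).card : ℝ)
          * Fintype.card ι := by rw [Finset.card_product, Finset.card_univ]; push_cast; ring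
      _ ≤ vol d ℓ k * Fintype.card ι := mul_le_mul_of_nonneg_right hblock (Nat.cast_nonneg _)
  have hV := vol_pos d ℓ k
  apply Real.sqrt_le_sqrt
  calc (vol d ℓ k)⁻¹ * (S.card : ℝ) ≤ (vol d ℓ k)⁻¹ * (vol d ℓ k * Fintype.card ι) :=
        mul_le_mul_of_nonneg_left hcard hw
    _ = Fintype.card ι := by field_simp

/-- **THEOREM (1.10), value member, GENERAL `Ω` UNDER `R₀`, FOR `f` SUPPORTED IN ONE UNIT BLOCK** — the print's
reduction «it is sufficient to prove the Proposition for a function f with support in a unit cube» (pp. 574–575) applied to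
`thm110_value_region`: with the same `K` (`8 ∣ K`) and a constant `c₀ > 0`, for every `(c, β)` there is `e₁ > 0` such
that for all the data of `thm110_value_region`, every unit label `y₀`, every `f` vanishing off `B(y₀) × colours` and
every `D` with `|x − x′|_∞ ≥ D` (fine units) on `B(y₀)`:
`|(G_k(Ω,A)f)(x)_i| ≤ c₀·exp(−D/(nK))·‖f‖_∞`. [cite: Balaban1983RegularityDecay, Theorem p.573 (1.10), §2 ¶1 p.575] -/
theorem thm110_value_region_unitBlock (F : OrthFlow ι) {ℓ₁ : ℝ} (hℓ₁ : 0 ≤ ℓ₁)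
    (hLip : ∀ t (v : ι → ℝ), ((F.U t - 1) *ᵥ v) ⬝ᵥ ((F.U t - 1) *ᵥ v) ≤ (ℓ₁ * t) ^ 2 * (v ⬝ᵥ v))
    (d ℓ : ℕ) (hℓ : 1 ≤ ℓ) (amin aplus m2plus : ℝ) (ha : 0 < amin) :
    ∃ K : ℕ, 8 ≤ K ∧ 8 ∣ K ∧ ∃ c₀ : ℝ, 0 < c₀ ∧ ∀ (creg β : ℝ), 0 ≤ creg → 0 < β →
      ∃ e₁ : ℝ, 0 < e₁ ∧ ∀ (k : ℕ), 1 ≤ k → ∀ (hn : 1 ≤ (ℓ + 1) ^ k) (a m2 : ℝ),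
      amin ≤ a → a ≤ aplus → 0 ≤ m2 → m2 ≤ m2plus →
      ∀ (Ωc : Finset (Fin (d + 1) → ℤ)), IsBlockUnion K Ωc →
      ∀ (Ac : (Fin (d + 1) → ℤ) → Fin (d + 1) → ℝ) (e : ℝ), 0 < e → e ≤ e₁ →
        (∀ x ∈ fineDom ((ℓ + 1) ^ k) Ωc, ∀ μ ν : Fin (d + 1),
          |Ac (x + e1 μ) ν - Ac x ν| ≤ creg * e ^ (β - 1) / ((ℓ + 1) ^ k : ℕ)) →
      ∀ (x : ↥(fineDom ((ℓ + 1) ^ k) Ωc)),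
        (∀ y : Fin (d + 1) → ℤ, (∀ μ, |y μ - blk ((ℓ + 1) ^ k) x.1 μ| ≤ (K : ℤ) * (d + 3)) → y ∈ Ωc) →
      ∀ (y₀ : Fin (d + 1) → ℤ) (D : ℝ),
        (∀ x' : ↥(fineDom ((ℓ + 1) ^ k) Ωc), blk ((ℓ + 1) ^ k) x'.1 = y₀ →
          ∃ μ, D ≤ |rpos ((ℓ + 1) ^ k) Ωc x μ - rpos ((ℓ + 1) ^ k) Ωc x' μ|) →
      ∀ (f : ↥(fineDom ((ℓ + 1) ^ k) Ωc) × ι → ℝ), (∀ p, blk ((ℓ + 1) ^ k) p.1.1 ≠ y₀ → f p = 0) →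
      ∀ i : ι,
        |((regionOp F e hn (B1.aSeq a ((ℓ : ℝ) + 1) k) m2 Ωc Ac)⁻¹ *ᵥ f) (x, i)|
          ≤ c₀ * Real.exp (-(D / ((((ℓ + 1) ^ k : ℕ) : ℝ) * K))) * ‖f‖ := by
  classical
  obtain ⟨K, hK8, h8, c₀, hc₀, H⟩ := thm110_value_region F hℓ₁ hLip d ℓ hℓ amin aplus m2plus ha
  refine ⟨K, hK8, h8, c₀ * max (Real.sqrt (Fintype.card ι)) 1, by positivity, fun creg β hcreg hβ => ?_⟩
  obtain ⟨e₁, he₁, H'⟩ := H creg β hcreg hβ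
  refine ⟨e₁, he₁, ?_⟩
  intro k hk hn a m2 ea1 ea2 em1 em2 Ωc hΩ Ac e he hle h17 x hxR y₀ D hD f hf i
  have hV : (1 : ℝ) ≤ max (Real.sqrt (Fintype.card ι)) 1 := le_max_right _ _
  have hfV : lpv (vol d ℓ k)⁻¹ 2 f ≤ max (Real.sqrt (Fintype.card ι)) 1 * ‖f‖ :=
    (lpv_two_le_unitBlock hn y₀ f hf).trans (mul_le_mul_of_nonneg_right (le_max_left _ _) (norm_nonneg f))
  have h := H' k hk hn a m2 ea1 ea2 em1 em2 Ωc hΩ Ac e he hle h17 x hxR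
    (fun x' => blk ((ℓ + 1) ^ k) x'.1 = y₀) D hD f (fun p hp => hf p hp) _ hV hfV i
  refine h.trans (le_of_eq ?_)
  ring

end Main

end

end Literature.MathematicalPhysics.QuantumFieldTheory.Balaban1983to89.B4Thm110RegionLp
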